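import Literature.Geometry.Lorentzian.Hintz2026.KerrTrappedSet

/-!
# Hintz 2026 [AF] §4.2.3 "Trapping III–IV": the EXPANSION RATES of the trapped set (Lemma 4.18, (4.49)–(4.50):
# `ν² = σ⁻²(−2μ∂²_rΦ) = 16r((r−𝔪)³ + 𝔪(𝔪²−a²))/(r−𝔪)² > 0` on `Γ₀`, Schwarzschild `ν̃ = 1/(3√3𝔪)`) and the ALGEBRA of
# `𝔯`-normal hyperbolicity (Prop. 4.19(3) = Dyatlov's Prop. 3.6, "we give the full details here"), WITH THE POLAR CHART
# (4.21)–(4.22) — so that `𝒞 > 0`, `σ > 0` and the photon shell now hold on `Γ₀` over the poles too — for ALL `|a| < 𝔪`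

#harness_tags [topic Geometry/Lorentzian]

CITATION HEADER (lean-in-tree rule 2026-08-18).  P. Hintz, *(Non-)Linear waves on asymptotically flat spacetimes. II*,
arXiv:2606.28008 **v1** (2026), bib key `Hintz2026WavesII` ("[AF]"; an UNREFEREED companion of the claim under adjudication
P. Hintz, *Nonlinear stability of subextremal Kerr black holes*, arXiv:2606.28253 **v2**, bib `Hintz2026`, "H"); "[AF] l.N" =
line N of its TeX source `nonstat2.tex` (md5 43f4362591de), numbers as in the `nonstat2.aux` shipped with H (= the public v1
PDF: Lemma 4.18 `LemmaTs3bOnu`, (4.49) `EqTs3bOnuExpr`, (4.50) `EqTs3bOnuMin`, Prop. 4.19 `PropTs3bONHyp`, (4.59)–(4.62),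
(4.21)–(4.22) `EqTs3bHCoordCart`/`EqTs3bHCarter`); "H l.N" = line N of `kerr-stab-r.tex` (md5 2c6513182847).  The REFEREED
anchor is S. Dyatlov, *Asymptotics of linear waves and resonances with applications to black holes*, Comm. Math. Phys. 335
(2015) 1445–1485 (bib `Dyatlov2015`; held arXiv:1305.1723, whose §2.x / Prop. 2.x = journal §3.x / Prop. 3.x): [AF] l.4752
"This was proved … in the full subextremal range by Dyatlov, whom we follow here", l.4868 "This is the content of [WZ11,
Prop. 2.1] for `|a/𝔪| ≪ 1` and [Dyatlov, Prop. 3.6] in the full subextremal range.  We give the full details here."  Written by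
the audit cell `pub-kerr` (HINTZ-PLAN.md HP-42; GAPS.md C-A26; ADEP.md §D.23), sequel of module `KerrTrappedSet` (HP-41), which
it imports and whose scope note "NOT formalised: … §§'Trapping III–IV' …, the poles `sin θ = 0` ([AF] uses `ω¹, ω²` there)"
it discharges in the algebraic part.  Nothing here is a dynamical or spectral statement: no flow, no (un)stable manifold, no
Hirsch–Pugh–Shub, no Arnold–Liouville; it is the finite algebra and one-variable calculus that those arguments are built on,
for every subextremal parameter, with every constant explicit.

## What is printed, and where it enters H

* H Prop. 8.3 `PropWETr` proves *strong* trapping admissibility of its linearised gauge-fixed Einstein operator, i.e. [AF]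
  Def. 5.8 `DefSSTrapAdm` ([AF] l.5309–5317: "`ρ_∞ (1/2i)(S_sub(P₀) − S_sub(P₀)*) < ½ν_min` at `Γ₀` … where `Γ₀` and `ν_min`
  were defined in Definition 4.13 and (4.50) … If [it] holds with right-hand side `ε` for every `ε > 0` … we say that `P₀` is
  *strongly trapping admissible*") — so the only property of `ν_min` H needs is (4.50): **`ν_min > 0`**; and [AF] Thm 9.16
  `ThmSpHi` ((Γ.4) `γ₊ − γ₋ = ν_min/(4β₀)`, [AF] l.8893–8914) is where it is consumed (cited H l.6025, 9837, 9841, 10452).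
* [AF] Lemma 4.18 `LemmaTs3bOnu` (l.4705–4717): the expansion rates `ν^{u/s}` of the defining functions (4.47)
  `φ₀^{u/s} = ξ ∓ sgn(r − r')√(−Φ⁰/μ)` under `σ⁻¹H_{G_3b}` are, at `Γ₀`, (4.49) `ν(z,ζ) := σ⁻¹√(−2μ(r')∂_r²Φ⁰_{(z,ζ)}(r'))`;
  "In particular, (4.50) `ν_min := min{inf_{Γ₀} ν^u, inf_{Γ₀} ν^s} > 0`.  Moreover, `{φ₀^u, φ₀^s}|_{Γ₀} = 2√(−(∂_r²Φ⁰/2μ))` is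
  everywhere non-zero."  Proof l.4719–4748: "`H_{G_3b}(2ξ) = −2μ'ξ² + 2Ψ/μ²`" (l.4730), "`2μ⁻²∂_rΨ = 2∂_r(μ⁻²Ψ) = −2∂_r²V = −2∂_r²Φ⁰`" (l.4741).
  `𝖧 := H_{G_3b}/(H_{G_3b}𝔱)` with "`H_{G_3b}𝔱 = 2ϱ²g⁻¹(d𝔱,·)` is positive" (l.4758); `ν̃^{u/s} = (σ/(H_{G_3b}𝔱))ν^{s/u} > 0` (l.4863).
* [AF] Prop. 4.19(3) `PropTs3bONHyp` (`𝔯`-normal hyperbolicity, tangential part (4.54)); proof l.4868–4949 reduces to the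
  Hamiltonian flow of `𝒞₁ := 𝒞|_{σ=1}` on `T*𝕊²` and prints: (i) l.4910–4911 "`𝒞₁` and `η_ϕ` are conserved … in involution …
  Away from the poles, [`d𝒞₁ ∧ dη_ϕ = 0`] iff `∂_{η_θ}𝒞₁ = 2η_θ = 0` and `∂_θ𝒞₁ = 2cot θ(a²sin²θ − η_ϕ²/sin²θ) = 0`, which for
  `θ ≠ π/2` implies `η_ϕ²/sin²θ = a²sin²θ`"; (ii) (4.61) `EqTs3bONHyp0` "`0 = G_3b|… = −μ⁻¹A² + 𝒞₁ = −μ⁻¹A² − 2aB`";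
  (iii) l.4914–4919 "We homogenize this term by inserting `σ = 1 = ϱ⁻²(−A + aB)`; and then
  `μ⁻¹A² + 2aB = (A²/μ)(1 − 2aμB/(Aϱ²)) + 2a²B²/ϱ²`.  Using (4.33) the term in parentheses is bounded from below by
  `1 − 2a√μ/ϱ²`; this is positive, as follows from `ϱ² ≥ r²` and `r⁴ ≥ 4a²μ`, the second inequality being equivalent to
  `(r² − 2a²)² + 8a²(𝔪r − a²) > 0`, which holds in view of `|a| < 𝔪 < r`.  Therefore (4.61) would imply `A = B = 0`, which … does
  not happen on `Γ₀`"; (iv) l.4919–4921 "At the poles on the other hand, we work with the expression (4.22) for `𝒞` …; thus at the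
  pole `(ω¹,ω²) = (0,0)`, we have `dη_ϕ = η₂dω¹ − η₁dω²` and `d𝒞₁ = 2η dη − 2a dη_ϕ`, which are linearly independent since
  `η = (η₁,η₂) ≠ 0` on `Γ_{𝕊²}`.  (The latter follows from (4.59) and the fact that `d𝔱` is not null.)"; (v) (4.62) `EqTs3bONHypFlow`
  the flow on the equatorial set `E = Γ_{𝕊²} ∩ {θ = π/2, η_θ = 0}`: "`∂_sϕ = 2(η_ϕ/sin²θ − a)`, `∂_sη_ϕ = 0`, `∂_sθ = 2η_θ`,
  `∂_sη_θ = −∂_θ𝒞₁`.  Therefore `θ(s) = π/2`, `ϕ(s) = 2s(η_ϕ(0) − a)`, `η_θ(s) = 0`, `η_ϕ(s) = η_ϕ(0)`"; (vi) l.4935–4948 the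
  linearisation "`∂_sv_θ = 2v_{η_θ}`, `∂_sv_{η_θ} = −∂_θ²𝒞₁ v_θ − ∂_{η_ϕ}∂_θ𝒞₁ v_{η_ϕ} = −∂_θ²𝒞₁ v_θ + 4η_ϕ(0)v_{η_ϕ}(0)`" and
  "the (constant) quantity `∂_θ²𝒞₁ = 2(η_ϕ² − a²)` is positive … `A² = μB² ≠ 0` at `E`.  Therefore, using `μ < r²+a²`, … equivalent
  to `η_ϕ² > r²+a² > 𝔪²+a²`.  Thus `∂_θ²𝒞₁ > 2𝔪² > 0`".
* [AF] (4.21)–(4.22) (l.4346–4361, the `𝓗⁺` subsection; re-used at l.4455–4466 in (4.30)'s second column): "Near the poles of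
  `𝕊²`, we need pass to smooth local coordinates, to wit, `ω¹ = sin θ cos ϕ₀`, `ω² = sin θ sin ϕ₀`,
  `η_θ dθ + η_{ϕ₀}dϕ₀ = η₁dω¹ + η₂dω²`; … `η_{ϕ₀} = ω¹η₂ − ω²η₁`, `g̸⁻¹ = ∂²_{ω¹} + ∂²_{ω²} − (ω¹∂_{ω¹} + ω²∂_{ω²})²`", and
  (4.22) `EqTs3bHCarter`: "`𝒞 := η_θ² + sin⁻²θ(−a sin²θ σ₀ + η_{ϕ₀})² = (η₁ + aσ₀ω²)² + (η₂ − aσ₀ω¹)² − (ω¹η₁ + ω²η₂)²`";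
  (4.30): "`A = −(r²+a²)σ + a(ω¹η₂ − ω²η₁)`, `B = ω¹η₂ − ω²η₁ − a(ω₁² + ω₂²)σ`".  (Dyatlov p.14 prints the same chart:
  `x₁ = sin θ cos φ`, `x₂ = sin θ sin φ`, `ξ_θ = (x₁ξ₁ + x₂ξ₂)cot θ`, `ξ_φ = x₁ξ₂ − x₂ξ₁`, "`G_θ = ξ₁² + ξ₂²` when `x₁ = x₂ = 0`".)

## What the kernel certifies (all real parameters unless stated)

§1 THE POLAR CHART: the pull-back `η₁dω¹ + η₂dω²` of the printed map `(θ,ϕ) ↦ ω = sin θ(cos ϕ, sin ϕ)` (certified partials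
`hasDerivAt_omega*`) has components `η_θ = cos θ(η₁cos ϕ + η₂sin ϕ) = cot θ(ω·η)`, `η_ϕ = ω¹η₂ − ω²η₁` (`pullback_components`,
`etaphi_transition`); `g̸⁻¹`: `η_θ² + η_ϕ²/sin²θ = η₁² + η₂² − (ω·η)²` (`roundDual_transition`); **(4.22) holds identically**
(`carterC_transition`: module 67's `carterC a sin²θ σ η_θ η_ϕ` = `carterCpol a ω¹ ω² σ η₁ η₂`, the printed right-hand side,
wherever `sin θ ≠ 0`); (4.30) second column (`Bfn_transition`, `Afn_polar`); and `G_3b` (`G3b_transition`).  In the polar chart the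
formulas are POLYNOMIAL, so they make sense AT the poles `ω = 0`, where `𝒞 = η₁² + η₂²`, `B = 0`, `η_ϕ = 0` (`*_at_pole`); the two
division-free structural identities `(ω₁²+ω₂²)·𝒞 = (1 − ω₁² − ω₂²)(ω·η)² + B²` (`normSq_mul_carterCpol`, the polar form of
"`sin²θ·𝒞 = sin²θ η_θ² + B²`") and `𝒞 = (1 − |ω|²)|η̃|² + (ω²η̃₁ − ω¹η̃₂)²`, `η̃ := (η₁ + aσω², η₂ − aσω¹)` (`carterCpol_lower`) carry the
whole §4 / §7 / §10 of module 76 over to each open hemisphere `{|ω| < 1}` INCLUDING its pole.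
§2 Γ₀ OVER THE POLES: with `OnGamma0Pol` (Def. 4.13's `(ξ, Ψ, G_3b) = 0` in the polar chart; `onGamma0Pol_transition` ↔ module 76's
`OnGamma0` off the poles), for `|ω|² < 1`, `μ > 0`, `r > 𝔪 > 0`: the zero-section lemma (`zero_section_pol`), `A ≠ 0`, **`𝒞 > 0`**
(`carterCpol_pos` — H l.5985's import, now on all of `Γ₀ ∖ o`), `μB² ≤ A²` ((4.33)), **(4.41)–(4.42) `σ·ϱ²g⁻¹(d𝔱,ζ) > 0`** and
**`σ > 0` on the future half** (`sigma_mul_dtPairing_pos_pol`, `sigma_pos_pol` — H l.7498's import), the trapped relations, the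
photon-orbit cubic `p(r) ≤ 0` and hence the SHARP SHELL `r_ph⁺ ≤ r ≤ r_ph⁻` (`trapped_radius_shell_pol`, `|a| < 𝔪`), the (4.44)
Jacobian `≠ 0` (`jac_det_ne_zero_pol`), and, AT a pole, Dyatlov's "`|∂_{ξ₁}G| + |∂_{ξ₂}G| > 0`": `η ≠ 0` (`eta_ne_zero_at_pole`) and
the POLAR photon-orbit cubic `r³ − 3𝔪r² + a²r + 𝔪a² = 0` (`polar_orbit_cubic`, the `η_ϕ = 0` member of the shell).
§3 LEMMA 4.18: `ν² := σ⁻²(−2μ·∂_r²Φ)` with module 76's CERTIFIED `∂_r²Φ` (`hasDerivAt_dPhi`) equals `2∂_rΨ/(μσ²)` at `Ψ = 0`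
(`nuSq_eq`, the printed assembly "`2μ⁻²∂_rΨ = −2∂_r²Φ⁰`"), is **POSITIVE on `Γ₀ ∖ o` for every `a² ≤ 𝔪², r > 𝔪, μ > 0`**
(`nuSq_pos` — the pointwise content of (4.50)), and on `Γ₀` takes the CLOSED FORM `ν² = 16r((r−𝔪)³ + 𝔪(𝔪²−a²))/(r−𝔪)²`,
free of `σ` and of the angular data (`nuSq_closed_form`; by (4.35)–(4.36)); `H_{G_3b}𝔱 = −∂_σG_3b = 2ϱ²g⁻¹(d𝔱,·)` (`HGt`,
`hasDerivAt_G3b_sigma_HGt` = module 76's `hasDerivAt_G3b_sigma`), so the `𝔱`-normalised rate is `ν̃² = σ²ν²/(2ϱ²g⁻¹(d𝔱,ζ))²` (`nuNormSq`, positive on the future half: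
`nuNormSq_pos`); SCHWARZSCHILD: `ν² = 108𝔪²`, `ϱ²g⁻¹(d𝔱,ζ) = 27𝔪²σ`, **`ν̃² = 1/(27𝔪²)`**, i.e. `ν̃ = 1/(3√3𝔪)` = Dyatlov's Prop. 3.8
`ν̃ = √(1−9ΛM²)/(3√3M)` at `Λ = 0` (`nuSq_schwarzschild`, `nuNormSq_schwarzschild`; also `∂_r²Φ = −18σ²` = his "`∂_r²G_r = −18τ²`").
|a|-DATUM: at `a² = 𝔪²` the closed form is `16r(r − 𝔪)`, which → 0 as the prograde orbit `r_ph⁺ → 𝔪 = r₊` (`nuSq_closed_form_extremal`;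
engine B's float table: `ν̃(r_ph⁺) = 0.192, 0.136, 0.060, 0.021, 0.0069` at `a/𝔪 = 0, 0.9, 0.99, 0.999, 0.9999`): (4.50) holds for each
`|a| < 𝔪` but not uniformly up to extremality (Dyatlov Prop. 3.9; [AF]/H use only `ν_min > 0`).
§4 PROP. 4.19(3), OFF THE POLES (BL chart, `0 < sin²θ ≤ 1`): the certified `θ`-, `η_θ`-, `η_ϕ`-partials of `𝒞` as printed
(`hasDerivAt_carterC_theta` = "`2cot θ(a²σ²sin²θ − η_ϕ²/sin²θ)`", `_etatheta` = `2η_θ`, `_etaphi` = "`2(η_ϕ/sin²θ − aσ)`" — `σ` kept,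
[AF] sets `σ = 1`); the degenerate locus `η_θ = 0 ∧ η_ϕ² = a²σ²sin⁴θ` gives `𝒞 = −2aσB` (`carterC_degenerate`, so (4.61) reads
`A²/μ + 2aσB = 0`); the HOMOGENISATION IDENTITY l.4917 verbatim (`homogenize`); `r⁴ − 4a²μ = (r²−2a²)² + 8a²(𝔪r − a²)` (`r4_sub`,
`ring`) and `r⁴ > 4a²μ` for `r > 𝔪 > 0`, `a² ≤ 𝔪²` (`four_a2_mu_lt_r4` — extremal `a` INCLUDED); the parenthesis is positive in the
squared, `√`-free form `(2aμB/(Aϱ²))² < 1` (`cross_term_sq_lt_one`); CONCLUSION (`nondegenerate_off_equator`): on `Σ ∩ {ξ = 0} ∖ o`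
(a fortiori on `Γ₀`) no point with `0 < sin²θ ≤ 1` has `η_θ = 0 ∧ η_ϕ² = a²σ²sin⁴θ` — i.e. `dη_ϕ ∧ d𝒞₁ ≠ 0` off `θ = π/2`.
§5 PROP. 4.19(3) AT THE POLES: certified partials of `η_ϕ = ω¹η₂ − ω²η₁` and of (4.22) at `ω = 0` — `dη_ϕ = η₂dω¹ − η₁dω²`,
`d𝒞 = 2η·dη − 2aσ dη_ϕ` EXACTLY AS PRINTED (`hasDerivAt_Lpol_*`, `hasDerivAt_carterCpol_*`, `pole_gradients`) — the two rows are linearly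
independent iff `η ≠ 0` (`pole_rows_independent`), `η ≠ 0` at pole points of `Σ ∩ {ξ=0} ∖ o` (`eta_ne_zero_at_pole`), and
`{η_ϕ, 𝒞} = 0` in the polar chart (`poisson_Lpol_carterCpol`, the printed "in involution", non-trivial only in this chart).
§6 THE EQUATORIAL SET `E`: the printed orbit solves Hamilton's equations of `𝒞` (`equatorial_orbit`, certified `HasDerivAt` in `s`);
`∂_θ²𝒞|_{θ=π/2} = 2(η_ϕ² − a²σ²)` (`hasDerivAt_dCarter_theta`, `d2Carter_equator`); the identity behind l.4944–4948
`(r²+a²)B² − A² = r²(η_ϕ² − (r²+a²)σ²)` at `sin²θ = 1` (`equator_identity`), `A² = μB²` at `E` ((4.33)), hence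
**`η_ϕ² > (r²+a²)σ²`** and **`∂_θ²𝒞 > 2r²σ² ≥ 2𝔪²σ²`** on `E ∖ o` for `r > 𝔪 > 0`, `μ > 0`, every real `a` (`etaphi_sq_gt`,
`d2Carter_equator_gt` — the printed "`> 2𝔪²`" at `σ = 1`).  AUDIT DATUM (NIL): the mixed partial `∂_{η_ϕ}∂_θ𝒞 = −4η_ϕcos θ/sin³θ`
(`hasDerivAt_dCarter_etaphi`) VANISHES at `θ = π/2` (`dCarter_etaphi_equator`), so the linearised system on `E` is the homogeneous
`∂_s²v_θ = −2∂_θ²𝒞₁v_θ`; [AF] l.4938/4942 print an inhomogeneity "`+ 4η_ϕ(0)v_{η_ϕ}(0)`" / "`+ 8η_ϕ(0)v_{η_ϕ}(0)`" (a bounded forcing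
either way; the conclusion (4.60) is unaffected; Dyatlov p.17 keeps the term symbolic).
§7 (4.50) MADE QUANTITATIVE (v2): on `Γ₀` the pairing has the closed form `ϱ²g⁻¹(d𝔱,ζ) = σ(4𝔪r²/(r−𝔪) + ϱ²)`
(`dtPairing_on_Gamma0`; so `H_{G_3b}𝔱 = 2σ(4𝔪r²/(r−𝔪) + ϱ²)`, `HGt_on_Gamma0`, a one-line second route to (4.41)–(4.42):
`sigma_mul_dtPairing_pos_of_trapped`), hence `ν̃² = 4r((r−𝔪)³ + 𝔪(𝔪²−a²))/(4𝔪r² + ϱ²(r−𝔪))²` (`nuNormSq_on_Gamma0`, `σ`-free; the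
only angular dependence is `ϱ² = r² + a²cos²θ`), and for `a² = 𝔪² − s²`, `s > 0`, on `Γ₀ ∖ o` (both charts, poles included):
**`ν² > 16(𝔪+s)s`** (`nuSq_gt`) and **`ν̃² > 4(𝔪²−a²)/(115²𝔪⁴)`, i.e. `ν̃ > (2/115)√(𝔪²−a²)/𝔪²`** (`nuNormSq_lower_bound`,
`nuNormSq_lower_bound_bl`, `nuNormSq_lower_bound_pol`) — an EXPLICIT `ν_min` for every subextremal Kerr (crude: Schwarzschild truth
`1/(27𝔪²)` vs bound `4/(115²𝔪²)`, `lower_bound_lt_schwarzschild_value`; near-extremal truth `ν̃(r_ph⁺) ≈ s/(2𝔪²)` by engine B),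
vanishing like `√(𝔪²−a²)` at extremality.

§8 (v4; computed here) PROP. 4.19(3) ON `E`, COMPLETED: the linearised `(v_θ, v_{η_θ})`-system of l.4935–4942, `∂_sv_θ = 2v_η`, `∂_sv_η = −Kv_θ` with `K = ∂_θ²𝒞₁|_E`, has the ELLIPTIC Jacobian `M = [[0, 2], [−K, 0]]`, **`M² = −2K·1`** (`tangJac_sq`; contrast the hyperbolic normal block of module `KerrTrappingPhasePortrait`, `J² = +σ²ν²·1`), the CONSERVED ENERGY `Kv_θ² + 2v_η²` along every solution (`energy_hasDerivAt_zero`, `energy_const`), hence for `K > 0` the UNIFORM bounds `Kv_θ(s)² ≤ E₀`, `2v_η(s)² ≤ E₀` for all `s` (`tangential_block_bounded` — no growth at all, a fortiori (4.60)'s `e^{εs}`), the explicit solution `v_θ = v_θ(0)cos(ωs) + (2v_η(0)/ω)sin(ωs)`, `v_η = v_η(0)cos(ωs) − (ωv_θ(0)/2)sin(ωs)`, `ω = √(2K)` (`oscillator_solution`, certified `HasDerivAt`), the linearly growing `(v_ϕ, v_{η_ϕ})`-block of l.4934 (`phi_block_solution`), and the assembly on `E ∖ o` with §6's `K = 2(η_ϕ²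 − a²σ²) > 2𝔪²σ² ≥ 0` (`equator_tangential_bounded`; every real `a`, `r > 𝔪 > 0`, `μ > 0`).

Deviation from print (said once): [AF] argues at `σ = 1` by homogeneity; the kernel keeps `σ` (every identity is the printed one
times the right power of `σ`).  The kernel's `nondegenerate_off_equator` is stated on `Σ ∩ {ξ = 0} ∖ o`, which contains [AF]'s
`Γ_{𝕊²}` (4.59).  NOT formalised: flows (except the LINEARISED flow on `E`, solved in §8), (un)stable manifolds `Γ₀^{u/s}`, Def. 4.15/4.17, Lemma 4.16 (now module `KerrTrappedSetRegularity`), Lemma 4.20, (4.52)–(4.58),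
the Arnold–Liouville step, the infimum in (4.50) AS AN INFIMUM (the kernel gives, instead, an explicit uniform lower bound on
`Γ₀ ∖ o`, §7, which is stronger), smoothness statements, anything of H §6/§8.
|a|-census (ADEP.md §D.23): §§1, 2 (signs), 4, 5, 6 hold for every real `a` given `μ > 0`, `r > 𝔪 > 0` (§4's `r⁴ > 4a²μ` is proved for
`a² ≤ 𝔪² < 𝔪r` — [AF]'s "in view of `|a| < 𝔪 < r`", extremality included); §2's shell and §3's closed form use `|a| < 𝔪` exactly as
module 76 does; §3's positivity holds pointwise for `a² ≤ 𝔪²` but its infimum over `Γ₀` degenerates as `|a| → 𝔪`.  Engines (cell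
`pub-kerr`, `code/adep1-g24/`): A = sympy 1.14 symbolic (43 checks incl. the trigonometric pull-back, the second
derivatives at `θ = π/2`, the mixed partial, the Poisson bracket, Hamilton's equations on `E`, the Schwarzschild values: PASS),
B = standard library only (exact rationals at random points for every polynomial identity and inequality under its hypotheses,
exact central differences for the polynomial partials, float differences for the trigonometric ones, 307 exact points of `Γ₀` in
the polar chart and 77 exact POLE points of `Γ₀` (polar photon orbits), the Schwarzschild values; seed 2424: 15513 checks, 0 fails).
[cite: Hintz2026WavesII, §4.2.3 'Trapping III-IV' TeX l.4640-4949: Lemma 4.18 `LemmaTs3bOnu` l.4705-4749 with (4.49)-(4.50), Prop. 4.19 `PropTs3bONHyp` l.4765-4790 and its proof l.4834-4949 with (4.59)-(4.62); §4.2.2 (4.21)-(4.22) `EqTs3bHCoordCart`/`EqTs3bHCarter` l.4346-4361; (4.30) l.4460-4466 (v1 PDF pp.83, 85, 89-94; claims of an unrefereed preprint, reproduced here); Hintz2026WavesII, Def. 5.8 `DefSSTrapAdm` l.5309-5317 and Thm 9.16 (Γ.4) l.8893-8914 (where ν_min is consumed); Hintz2026, Prop. 8.3 `PropWETr` TeX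 l.7395-7403 (strong trapping admissibility, the import site);
Dyatlov2015, §3.1 (polar coordinates x₁, x₂ and 'G_θ = ξ₁² + ξ₂² at the poles', held arXiv text p.14), §3.2 Prop. 3.6 (tangential growth e^{ε|s|}; held text Prop. 2.6 p.17 incl. Cases 1-2 and '∂_θ²G = 2(ξ_φ² − a²τ²) > 0 on K̃_e', 'ξ_φ²/sin²θ > (r²+a²)τ²' p.16), Prop. 3.7 with the rate 'ν̃ = √(−2Δ_r∂_r²G_r)/|∂_τG|' (held text (e:tilde-nu) p.17), §3.3 Prop. 3.8 (Schwarzschild(-de Sitter): 'ν̃ = √(1−9ΛM²)/(3√3M)', '∂_r²G_r = −18τ²', '∂_τG = −54M²τ'; held text Prop. 2.8 p.18) and Prop. 3.9 (ν_min → 0 as a → M; held text p.4 and Prop. 2.9); Chandrasekhar1998, ch. 7 §63 eqs. (224)-(228); Teo2003, §2]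
-/

open Matrix

noncomputable section

namespace Literature.Geometry.Lorentzian.Hintz2026.KerrTrappedSetDynamics

open Literature.Geometry.Lorentzian.Hintz2026.KerrDualMetricForm
open Literature.Geometry.Lorentzian.Hintz2026.CarterTetradFrame
open Literature.Geometry.Lorentzian.Hintz2026.KerrTrappedSet

/-! ## 1. [AF] (4.21)–(4.22) and (4.30) second column: the polar chart `ω = sin θ(cos ϕ, sin ϕ)`, `η_θdθ + η_ϕdϕ = η₁dω¹ + η₂dω²` -/

/-- `η_ϕ = ω¹η₂ − ω²η₁` — the (smooth) angular momentum about the axis in the polar chart.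
[cite: Hintz2026WavesII, eq. (4.21) `EqTs3bHCoordCart` TeX l.4353 (transcription); Dyatlov2015, §3.1 ('ξ_φ = x₁ξ₂ − x₂ξ₁', held text p.14)] -/
def Lpol (ω₁ ω₂ η₁ η₂ : ℝ) : ℝ := ω₁ * η₂ - ω₂ * η₁

/-- `|ω|² = ω₁² + ω₂²` (= `sin²θ` on the chart). [cite: Hintz2026WavesII, eq. (4.30) TeX l.4464 ('ω₁² + ω₂²'); Dyatlov2015, §3.1 ('sin²θ = x₁² + x₂²', held text p.14)] -/
def normSq (ω₁ ω₂ : ℝ) : ℝ := ω₁ ^ 2 + ω₂ ^ 2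

/-- The round dual metric in the polar chart: `g̸⁻¹(η,η) = η₁² + η₂² − (ω¹η₁ + ω²η₂)²` ("`g̸⁻¹ = ∂²_{ω¹} + ∂²_{ω²} − (ω¹∂_{ω¹} + ω²∂_{ω²})²`").
[cite: Hintz2026WavesII, eq. (4.21) `EqTs3bHCoordCart` TeX l.4354 (transcription)] -/
def roundDualPol (ω₁ ω₂ η₁ η₂ : ℝ) : ℝ := η₁ ^ 2 + η₂ ^ 2 - (ω₁ * η₁ + ω₂ * η₂) ^ 2

/-- **(4.22) `EqTs3bHCarter`, right-hand side**: `𝒞 = (η₁ + aσω²)² + (η₂ − aσω¹)² − (ω¹η₁ + ω²η₂)²` — a POLYNOMIAL, hence defined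
at the poles `ω = 0`. [cite: Hintz2026WavesII, eq. (4.22) `EqTs3bHCarter` TeX l.4361 (transcription)] -/
def carterCpol (a ω₁ ω₂ σ η₁ η₂ : ℝ) : ℝ :=
  (η₁ + a * σ * ω₂) ^ 2 + (η₂ - a * σ * ω₁) ^ 2 - (ω₁ * η₁ + ω₂ * η₂) ^ 2

/-- (4.30), second column: `B = ω¹η₂ − ω²η₁ − a(ω₁² + ω₂²)σ`. [cite: Hintz2026WavesII, eq. (4.30) `EqTs3bOAB` TeX l.4464 (transcription)] -/
def Bpol (a ω₁ ω₂ σ η₁ η₂ : ℝ) : ℝ := Lpol ω₁ ω₂ η₁ η₂ - a * normSq ω₁ ω₂ * σ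

/-- `G_3b` in the polar chart: `μξ² − μ⁻¹A² + 𝒞` with `A = −(r²+a²)σ + aη_ϕ`, `η_ϕ = ω¹η₂ − ω²η₁` (module 76's `sG`) and the
polynomial `𝒞` of (4.22). [cite: Hintz2026WavesII, eqs. (4.30)/(4.32) TeX l.4463, l.4477-4478 with (4.22) l.4361 (transcription)] -/
def G3bpol (m a r ω₁ ω₂ σ ξ η₁ η₂ : ℝ) : ℝ :=
  sG m a r σ ξ (Lpol ω₁ ω₂ η₁ η₂) + carterCpol a ω₁ ω₂ σ η₁ η₂

section Chart

/-! ### 1a. The chart map and its certified partials: `ω¹ = sin θ cos ϕ`, `ω² = sin θ sin ϕ` -/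

/-- `∂_θω¹ = cos θ cos ϕ`. [cite: Hintz2026WavesII, eq. (4.21) TeX l.4349 (computed here)] -/
theorem hasDerivAt_omega1_theta (θ φ : ℝ) :
    HasDerivAt (fun t => Real.sin t * Real.cos φ) (Real.cos θ * Real.cos φ) θ :=
  (Real.hasDerivAt_sin θ).mul_const _

/-- `∂_ϕω¹ = −sin θ sin ϕ`. [cite: Hintz2026WavesII, eq. (4.21) TeX l.4349 (computed here)] -/
theorem hasDerivAt_omega1_phi (θ φ : ℝ) :
    HasDerivAt (fun p => Real.sin θ * Real.cos p) (-(Real.sin θ * Real.sin φ)) φ := by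
  simpa using (Real.hasDerivAt_cos φ).const_mul (Real.sin θ)

/-- `∂_θω² = cos θ sin ϕ`. [cite: Hintz2026WavesII, eq. (4.21) TeX l.4349 (computed here)] -/
theorem hasDerivAt_omega2_theta (θ φ : ℝ) :
    HasDerivAt (fun t => Real.sin t * Real.sin φ) (Real.cos θ * Real.sin φ) θ :=
  (Real.hasDerivAt_sin θ).mul_const _

/-- `∂_ϕω² = sin θ cos ϕ`. [cite: Hintz2026WavesII, eq. (4.21) TeX l.4349 (computed here)] -/
theorem hasDerivAt_omega2_phi (θ φ : ℝ) :
    HasDerivAt (fun p => Real.sin θ * Real.sin p) (Real.sin θ * Real.cos φ) φ :=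
  (Real.hasDerivAt_sin φ).const_mul (Real.sin θ)

/-- **The pull-back `η₁dω¹ + η₂dω² = η_θdθ + η_ϕdϕ` in components**: `η_θ = η₁∂_θω¹ + η₂∂_θω² = cos θ(η₁cos ϕ + η₂sin ϕ)` and
`η_ϕ = η₁∂_ϕω¹ + η₂∂_ϕω² = sin θ(−η₁sin ϕ + η₂cos ϕ)`. [cite: Hintz2026WavesII, eq. (4.21) `EqTs3bHCoordCart` TeX l.4349 (computed here); Dyatlov2015, §3.1 (held text p.14)] -/
theorem pullback_components (θ φ η₁ η₂ : ℝ) :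
    η₁ * (Real.cos θ * Real.cos φ) + η₂ * (Real.cos θ * Real.sin φ)
        = Real.cos θ * (η₁ * Real.cos φ + η₂ * Real.sin φ) ∧
      η₁ * (-(Real.sin θ * Real.sin φ)) + η₂ * (Real.sin θ * Real.cos φ)
        = Real.sin θ * (-(η₁ * Real.sin φ) + η₂ * Real.cos φ) := by
  constructor <;> ring

/-! ### 1b. The transition identities, algebraically: `sθ² + cθ² = 1`, `cφ² + sφ² = 1`, `ω = (sθcφ, sθsφ)`,
`η_θ = cθ(η₁cφ + η₂sφ)`, `η_ϕ = sθ(−η₁sφ + η₂cφ)` -/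

variable (a m r σ ξ sθ cθ cφ sφ η₁ η₂ : ℝ)

/-- **`η_ϕ = ω¹η₂ − ω²η₁`.** [cite: Hintz2026WavesII, eq. (4.21) TeX l.4353 (reproduced); Dyatlov2015, §3.1 (held text p.14)] -/
theorem etaphi_transition : sθ * (-(η₁ * sφ) + η₂ * cφ) = Lpol (sθ * cφ) (sθ * sφ) η₁ η₂ := by
  unfold Lpol; ring

/-- **`η_θ = cot θ(ω·η)`**, here as `sθ·η_θ = cθ·(ω·η)`. [cite: Dyatlov2015, §3.1 ('ξ_θ = (x₁ξ₁ + x₂ξ₂)cot θ', held text p.14; reproduced)] -/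
theorem etatheta_transition :
    sθ * (cθ * (η₁ * cφ + η₂ * sφ)) = cθ * (sθ * cφ * η₁ + sθ * sφ * η₂) := by ring

/-- `|ω|² = sin²θ`. [cite: Hintz2026WavesII, eq. (4.30) TeX l.4464; Dyatlov2015, §3.1 (reproduced)] -/
theorem normSq_transition (hφ : cφ ^ 2 + sφ ^ 2 = 1) : normSq (sθ * cφ) (sθ * sφ) = sθ ^ 2 := by
  unfold normSq
  linear_combination sθ ^ 2 * hφ

/-- **`g̸⁻¹ = ∂²_{ω¹} + ∂²_{ω²} − (ω¹∂_{ω¹} + ω²∂_{ω²})²`**: `η_θ² + η_ϕ²/sin²θ = η₁² + η₂² − (ω·η)²` (`sin θ ≠ 0`).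
[cite: Hintz2026WavesII, eq. (4.21) `EqTs3bHCoordCart` TeX l.4354 (reproduced)] -/
theorem roundDual_transition (hθ : sθ ^ 2 + cθ ^ 2 = 1) (hφ : cφ ^ 2 + sφ ^ 2 = 1) (hs : sθ ≠ 0) :
    (cθ * (η₁ * cφ + η₂ * sφ)) ^ 2 + (sθ * (-(η₁ * sφ) + η₂ * cφ)) ^ 2 / sθ ^ 2
      = roundDualPol (sθ * cφ) (sθ * sφ) η₁ η₂ := by
  unfold roundDualPol
  have hq : (sθ * (-(η₁ * sφ) + η₂ * cφ)) ^ 2 / sθ ^ 2 = (-(η₁ * sφ) + η₂ * cφ) ^ 2 := by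
    field_simp
  rw [hq]
  linear_combination (η₁ * cφ + η₂ * sφ) ^ 2 * hθ + (η₁ ^ 2 + η₂ ^ 2) * hφ

/-- **(4.22) `EqTs3bHCarter` holds identically**: module 67's `𝒞 = η_θ² + sin⁻²θ(−a sin²θ σ + η_ϕ)²`, evaluated on the chart, IS the
printed polynomial `(η₁ + aσω²)² + (η₂ − aσω¹)² − (ω¹η₁ + ω²η₂)²` (`sin θ ≠ 0`). [cite: Hintz2026WavesII, eq. (4.22) `EqTs3bHCarter` TeX l.4358-4361 (reproduced)] -/
theorem carterC_transition (hθ : sθ ^ 2 + cθ ^ 2 = 1) (hφ : cφ ^ 2 + sφ ^ 2 = 1) (hs : sθ ≠ 0) :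
    carterC a (sθ ^ 2) σ (cθ * (η₁ * cφ + η₂ * sφ)) (sθ * (-(η₁ * sφ) + η₂ * cφ))
      = carterCpol a (sθ * cφ) (sθ * sφ) σ η₁ η₂ := by
  unfold carterC carterCpol
  have hq : 1 / sθ ^ 2 * (-(a * sθ ^ 2 * σ) + sθ * (-(η₁ * sφ) + η₂ * cφ)) ^ 2
      = (-(a * sθ * σ) + (-(η₁ * sφ) + η₂ * cφ)) ^ 2 := by
    field_simp
  rw [hq]
  linear_combination (η₁ * cφ + η₂ * sφ) ^ 2 * hθ + (η₁ ^ 2 + η₂ ^ 2 - a ^ 2 * σ ^ 2 * sθ ^ 2) * hφ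

/-- (4.30), second column, for `B`: `−a sin²θ σ + η_ϕ = ω¹η₂ − ω²η₁ − a(ω₁²+ω₂²)σ` on the chart.
[cite: Hintz2026WavesII, eq. (4.30) `EqTs3bOAB` TeX l.4464 (reproduced)] -/
theorem Bfn_transition (hφ : cφ ^ 2 + sφ ^ 2 = 1) :
    Bfn a (sθ ^ 2) σ (sθ * (-(η₁ * sφ) + η₂ * cφ)) = Bpol a (sθ * cφ) (sθ * sφ) σ η₁ η₂ := by
  unfold Bfn Bpol Lpol normSq
  linear_combination (a * σ * sθ ^ 2) * hφ

/-- (4.30), second column, for `A`: `−(r²+a²)σ + aη_ϕ = −(r²+a²)σ + a(ω¹η₂ − ω²η₁)` — module 76's `Afn a r σ η_ϕ` at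
`η_ϕ = Lpol` (definitional). [cite: Hintz2026WavesII, eq. (4.30) `EqTs3bOAB` TeX l.4463 (transcription check)] -/
theorem Afn_polar (ω₁ ω₂ : ℝ) :
    Afn a r σ (Lpol ω₁ ω₂ η₁ η₂) = -((r ^ 2 + a ^ 2) * σ) + a * (ω₁ * η₂ - ω₂ * η₁) := rfl

/-- `ϱ² = r² + a²cos²θ = r² + a²(1 − |ω|²)`: module 65's `rhoSq a r s2` at `s2 = |ω|²` (definitional). [cite: Hintz2026WavesII, eq. (4.2) TeX l.4039 (transcription check)] -/
theorem rhoSq_polar (ω₁ ω₂ : ℝ) : rhoSq a r (normSq ω₁ ω₂) = r ^ 2 + a ^ 2 * (1 - (ω₁ ^ 2 + ω₂ ^ 2)) := rfl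

/-- `G_3b` on the chart equals module 76's `G3b` (`sin θ ≠ 0`). [cite: Hintz2026WavesII, eq. (4.32) TeX l.4477-4478 with (4.22) l.4361 (reproduced)] -/
theorem G3b_transition (hθ : sθ ^ 2 + cθ ^ 2 = 1) (hφ : cφ ^ 2 + sφ ^ 2 = 1) (hs : sθ ≠ 0) :
    G3b m a r (sθ ^ 2) σ ξ (cθ * (η₁ * cφ + η₂ * sφ)) (sθ * (-(η₁ * sφ) + η₂ * cφ))
      = G3bpol m a r (sθ * cφ) (sθ * sφ) σ ξ η₁ η₂ := by
  unfold G3b G3bpol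
  rw [carterC_transition a σ sθ cθ cφ sφ η₁ η₂ hθ hφ hs, etaphi_transition]

/-- The trigonometric instance: with `sθ = sin θ`, `cθ = cos θ`, `cφ = cos ϕ`, `sφ = sin ϕ` the hypotheses `sθ² + cθ² = 1`,
`cφ² + sφ² = 1` hold, so (4.22) holds on the actual chart wherever `sin θ ≠ 0`. [cite: Hintz2026WavesII, eq. (4.22) `EqTs3bHCarter` TeX l.4358-4361 (reproduced)] -/
theorem carterC_transition_trig (θ φ : ℝ) (hs : Real.sin θ ≠ 0) :
    carterC a (Real.sin θ ^ 2) σ (Real.cos θ * (η₁ * Real.cos φ + η₂ * Real.sin φ))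
        (Real.sin θ * (-(η₁ * Real.sin φ) + η₂ * Real.cos φ))
      = carterCpol a (Real.sin θ * Real.cos φ) (Real.sin θ * Real.sin φ) σ η₁ η₂ :=
  carterC_transition a σ _ _ _ _ η₁ η₂ (Real.sin_sq_add_cos_sq θ) (Real.cos_sq_add_sin_sq φ) hs

end Chart

/-! ### 1c. Division-free structural identities of the polar `𝒞` (valid for every `ω`, in particular at the poles) -/

section Structure

variable (a ω₁ ω₂ σ η₁ η₂ : ℝ)

/-- AT A POLE (`ω = 0`): `𝒞 = η₁² + η₂²` (Dyatlov: "`G_θ = ξ₁² + ξ₂²` when `x₁ = x₂ = 0`"). [cite: Hintz2026WavesII, eq. (4.22) TeX l.4361 (computed here); Dyatlov2015, §3.1 (held text p.14 display 'G_θ = (1+α)(ξ₁²+ξ₂²) when x₁ = x₂ = 0', α = 0)] -/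
theorem carterCpol_at_pole : carterCpol a 0 0 σ η₁ η₂ = η₁ ^ 2 + η₂ ^ 2 := by
  unfold carterCpol; ring

/-- At a pole `B = 0`. [cite: Hintz2026WavesII, eq. (4.30) TeX l.4464 (computed here)] -/
theorem Bpol_at_pole : Bpol a 0 0 σ η₁ η₂ = 0 := by
  unfold Bpol Lpol normSq; ring

/-- At a pole `η_ϕ = 0` ("`ξ_φ` is a smooth function vanishing at the poles", Dyatlov p.14). [cite: Dyatlov2015, §3.1 (held text p.14); Hintz2026WavesII, eq. (4.21) TeX l.4353 (computed here)] -/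
theorem Lpol_at_pole : Lpol 0 0 η₁ η₂ = 0 := by
  unfold Lpol; ring

/-- `B` in the polar chart is module 76's `Bfn` at `s2 = |ω|²`, `η_ϕ = ω¹η₂ − ω²η₁` (definitional bridge).
[cite: Hintz2026WavesII, eq. (4.30) TeX l.4464 (transcription check)] -/
theorem Bpol_eq_Bfn : Bpol a ω₁ ω₂ σ η₁ η₂ = Bfn a (normSq ω₁ ω₂) σ (Lpol ω₁ ω₂ η₁ η₂) := by
  unfold Bpol Bfn; ring

/-- `𝒞 = |η̃|² − (ω·η̃)²` with `η̃ := (η₁ + aσω², η₂ − aσω¹)` and `ω·η̃ = ω·η`: (4.22) is the round dual metric `g̸⁻¹` of l.4354 applied to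
the shifted momentum `η̃`. [cite: Hintz2026WavesII, eqs. (4.21)-(4.22) TeX l.4354, l.4361 (structure computed here)] -/
theorem carterCpol_eq_roundDual_shift :
    carterCpol a ω₁ ω₂ σ η₁ η₂ = roundDualPol ω₁ ω₂ (η₁ + a * σ * ω₂) (η₂ - a * σ * ω₁) := by
  unfold carterCpol roundDualPol; ring

/-- **The polar form of "`sin²θ·𝒞 = sin²θ η_θ² + B²`"**: `(ω₁²+ω₂²)·𝒞 = (1 − ω₁² − ω₂²)(ω·η)² + B²` — an identity with NO division,
valid at `ω = 0` too (there it reads `0 = 0`; cf. module 76 `s2_mul_carterC`, and `sin²θ η_θ² = cos²θ(ω·η)²` by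
`etatheta_transition`). [cite: Hintz2026WavesII, eq. (4.32) TeX l.4478 with (4.22) l.4361 (computed here)] -/
theorem normSq_mul_carterCpol :
    normSq ω₁ ω₂ * carterCpol a ω₁ ω₂ σ η₁ η₂
      = (1 - normSq ω₁ ω₂) * (ω₁ * η₁ + ω₂ * η₂) ^ 2 + Bpol a ω₁ ω₂ σ η₁ η₂ ^ 2 := by
  unfold normSq carterCpol Bpol Lpol normSq; ring

/-- **Lagrange's identity for (4.22)**: `𝒞 − (1 − |ω|²)|η̃|² = (ω²η̃₁ − ω¹η̃₂)² ≥ 0`, so `𝒞 ≥ (1 − |ω|²)|η̃|²` — on an open hemisphere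
(`|ω| < 1`) `𝒞 = 0` forces `η̃ = 0`. [cite: Hintz2026WavesII, eq. (4.22) TeX l.4361 (computed here)] -/
theorem carterCpol_lower :
    carterCpol a ω₁ ω₂ σ η₁ η₂ - (1 - normSq ω₁ ω₂) * ((η₁ + a * σ * ω₂) ^ 2 + (η₂ - a * σ * ω₁) ^ 2)
      = (ω₂ * (η₁ + a * σ * ω₂) - ω₁ * (η₂ - a * σ * ω₁)) ^ 2 := by
  unfold carterCpol normSq; ring

/-- `𝒞 ≥ 0` on the closed hemisphere `|ω|² ≤ 1`. [cite: Hintz2026WavesII, eq. (4.22) TeX l.4361 (computed here)] -/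
theorem carterCpol_nonneg (hu : normSq ω₁ ω₂ ≤ 1) : 0 ≤ carterCpol a ω₁ ω₂ σ η₁ η₂ := by
  have h := carterCpol_lower a ω₁ ω₂ σ η₁ η₂
  nlinarith [sq_nonneg (ω₂ * (η₁ + a * σ * ω₂) - ω₁ * (η₂ - a * σ * ω₁)),
    mul_nonneg (sub_nonneg.mpr hu) (add_nonneg (sq_nonneg (η₁ + a * σ * ω₂)) (sq_nonneg (η₂ - a * σ * ω₁)))]

/-- `B² ≤ |ω|²·𝒞 ≤ 𝒞` on `|ω|² ≤ 1` (the polar (4.33)-type bound "`B² ≤ 𝒞`", [AF] l.4543). [cite: Hintz2026WavesII, proof of Lemma 4.12 TeX l.4543 ('B² ≤ 𝒞'; reproduced in the polar chart)] -/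
theorem Bpol_sq_le_carterCpol (hu : normSq ω₁ ω₂ ≤ 1) :
    Bpol a ω₁ ω₂ σ η₁ η₂ ^ 2 ≤ carterCpol a ω₁ ω₂ σ η₁ η₂ := by
  have h := normSq_mul_carterCpol a ω₁ ω₂ σ η₁ η₂
  have hC := carterCpol_nonneg a ω₁ ω₂ σ η₁ η₂ hu
  have hu0 : 0 ≤ normSq ω₁ ω₂ := by unfold normSq; positivity
  nlinarith [mul_nonneg (sub_nonneg.mpr hu) (sq_nonneg (ω₁ * η₁ + ω₂ * η₂)), mul_nonneg (sub_nonneg.mpr hu) hC]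

/-- "`in particular, σ = ϱ⁻²(−A + aB)`" in the polar chart: `ϱ²σ = −A + aB` with `ϱ² = r² + a²(1 − |ω|²)`.
[cite: Hintz2026WavesII, TeX l.4467 (reproduced in the polar chart)] -/
theorem rhoSq_mul_sigma_pol (r : ℝ) :
    rhoSq a r (normSq ω₁ ω₂) * σ = -Afn a r σ (Lpol ω₁ ω₂ η₁ η₂) + a * Bpol a ω₁ ω₂ σ η₁ η₂ := by
  rw [Bpol_eq_Bfn]
  exact rhoSq_mul_sigma a r _ σ _

end Structure

/-! ## 2. `Γ₀` in the polar chart, INCLUDING THE POLES: Def. 4.13, `𝒞 > 0`, (4.41)–(4.42), the shell, (4.44) -/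

/-- Def. 4.13's `(ξ, Ψ, G_3b) = (0,0,0)` in the polar chart (`Ψ` depends on the fibre only through `σ` and `η_ϕ = ω¹η₂ − ω²η₁`).
[cite: Hintz2026WavesII, Def. 4.13 `DefTs3bOTrap0` TeX l.4607-4613 and l.4626 (transcription, polar chart)] -/
def OnGamma0Pol (m a r ω₁ ω₂ σ ξ η₁ η₂ : ℝ) : Prop :=
  ξ = 0 ∧ Psi m a r σ (Lpol ω₁ ω₂ η₁ η₂) = 0 ∧ G3bpol m a r ω₁ ω₂ σ ξ η₁ η₂ = 0

section Gamma0Polar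

variable {m a r s σ ξ ω₁ ω₂ η₁ η₂ : ℝ}

/-- Off the poles the polar predicate IS module 76's `OnGamma0` (transition of §1b, `sin θ ≠ 0`).
[cite: Hintz2026WavesII, Def. 4.13 TeX l.4607-4613 with (4.21)-(4.22) l.4346-4361 (reproduced)] -/
theorem onGamma0Pol_transition (sθ cθ cφ sφ : ℝ) (hθ : sθ ^ 2 + cθ ^ 2 = 1) (hφ : cφ ^ 2 + sφ ^ 2 = 1) (hs : sθ ≠ 0) :
    OnGamma0Pol m a r (sθ * cφ) (sθ * sφ) σ ξ η₁ η₂ ↔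
      OnGamma0 m a r (sθ ^ 2) σ ξ (cθ * (η₁ * cφ + η₂ * sφ)) (sθ * (-(η₁ * sφ) + η₂ * cφ)) := by
  unfold OnGamma0Pol OnGamma0
  rw [G3b_transition a m r σ ξ sθ cθ cφ sφ η₁ η₂ hθ hφ hs, etaphi_transition]

/-- (4.33) in the polar chart: on `{ξ = 0, G_3b = 0}`, `𝒞 = μ⁻¹A²`. [cite: Hintz2026WavesII, eq. (4.33) `EqTs3bOConvexEst` TeX l.4489-4492 (reproduced, polar chart)] -/
theorem carterCpol_eq_of_onSigma (hξ : ξ = 0) (hG : G3bpol m a r ω₁ ω₂ σ ξ η₁ η₂ = 0) :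
    carterCpol a ω₁ ω₂ σ η₁ η₂ = Afn a r σ (Lpol ω₁ ω₂ η₁ η₂) ^ 2 / mu m a r := by
  subst hξ
  simp only [G3bpol, sG, Vfn] at hG
  linear_combination hG

/-- **The zero-section lemma over a whole hemisphere** ([AF] l.4488 / l.4637: "`A = 0` would imply `𝒞 = 0`, and hence … we would be
at the zero section"; l.4386 "… and `η₁ = η₂ = 0` at the poles"): for `|ω|² < 1` and `ϱ² = r² + a²(1 − |ω|²) > 0`, the conditions
`ξ = 0`, `G_3b = 0`, `A = 0` force `σ = η₁ = η₂ = 0`. [cite: Hintz2026WavesII, TeX l.4386, l.4488, l.4637 (reproduced in the polar chart, poles included)] -/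
theorem zero_section_pol (hu : normSq ω₁ ω₂ < 1) (hρ : 0 < rhoSq a r (normSq ω₁ ω₂)) (hξ : ξ = 0)
    (hG : G3bpol m a r ω₁ ω₂ σ ξ η₁ η₂ = 0) (hA : Afn a r σ (Lpol ω₁ ω₂ η₁ η₂) = 0) :
    σ = 0 ∧ η₁ = 0 ∧ η₂ = 0 := by
  have hC := carterCpol_eq_of_onSigma hξ hG
  rw [hA] at hC
  simp only [ne_eq, OfNat.ofNat_ne_zero, not_false_eq_true, zero_pow, zero_div] at hC
  -- `𝒞 = 0` and `|ω| < 1` ⇒ `η̃ = 0`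
  have hL := carterCpol_lower a ω₁ ω₂ σ η₁ η₂
  rw [hC] at hL
  have h1u : 0 < 1 - normSq ω₁ ω₂ := sub_pos.mpr hu
  have hsum : (1 - normSq ω₁ ω₂) * ((η₁ + a * σ * ω₂) ^ 2 + (η₂ - a * σ * ω₁) ^ 2) ≤ 0 := by
    nlinarith [sq_nonneg (ω₂ * (η₁ + a * σ * ω₂) - ω₁ * (η₂ - a * σ * ω₁))]
  have hsq : (η₁ + a * σ * ω₂) ^ 2 + (η₂ - a * σ * ω₁) ^ 2 ≤ 0 := by
    by_contra hc
    have : 0 < (1 - normSq ω₁ ω₂) * ((η₁ + a * σ * ω₂) ^ 2 + (η₂ - a * σ * ω₁) ^ 2) :=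
      mul_pos h1u (lt_of_not_ge hc)
    linarith
  have e1 : η₁ + a * σ * ω₂ = 0 := by nlinarith [sq_nonneg (η₁ + a * σ * ω₂), sq_nonneg (η₂ - a * σ * ω₁)]
  have e2 : η₂ - a * σ * ω₁ = 0 := by nlinarith [sq_nonneg (η₁ + a * σ * ω₂), sq_nonneg (η₂ - a * σ * ω₁)]
  -- then `A = −σϱ²`, so `σ = 0`
  have hAe : Afn a r σ (Lpol ω₁ ω₂ η₁ η₂) = -(σ * rhoSq a r (normSq ω₁ ω₂)) := by
    have h1 : η₁ = -(a * σ * ω₂) := by linarith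
    have h2 : η₂ = a * σ * ω₁ := by linarith
    simp only [Afn, Lpol, rhoSq, normSq, h1, h2]
    ring
  rw [hAe] at hA
  have hσ : σ = 0 := by
    rcases mul_eq_zero.mp (neg_eq_zero.mp hA) with h | h
    · exact h
    · exact absurd h hρ.ne'
  subst hσ
  refine ⟨rfl, ?_, ?_⟩ <;> simp at e1 e2 <;> assumption

/-- `|ω|² < 1` gives `ϱ² = r² + a²(1 − |ω|²) > 0` as soon as `r ≠ 0`. [cite: Hintz2026WavesII, eq. (4.2) TeX l.4039 (computed here)] -/
theorem rhoSq_pol_pos (hu : normSq ω₁ ω₂ < 1) (hr : r ≠ 0) : 0 < rhoSq a r (normSq ω₁ ω₂) := by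
  simp only [rhoSq]
  have : 0 < r ^ 2 := by positivity
  nlinarith [mul_nonneg (sq_nonneg a) (sub_nonneg.mpr hu.le)]

/-- **`A ≠ 0` on `{ξ = 0} ∩ Σ ∖ o` over the whole hemisphere.** [cite: Hintz2026WavesII, TeX l.4488, l.4637 (reproduced, poles included)] -/
theorem A_ne_zero_pol (hu : normSq ω₁ ω₂ < 1) (hρ : 0 < rhoSq a r (normSq ω₁ ω₂)) (hξ : ξ = 0)
    (hG : G3bpol m a r ω₁ ω₂ σ ξ η₁ η₂ = 0) (hne : ¬(σ = 0 ∧ ξ = 0 ∧ η₁ = 0 ∧ η₂ = 0)) :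
    Afn a r σ (Lpol ω₁ ω₂ η₁ η₂) ≠ 0 := fun hA => by
  obtain ⟨h1, h2, h3⟩ := zero_section_pol hu hρ hξ hG hA
  exact hne ⟨h1, hξ, h2, h3⟩

/-- **"`𝒞 > 0` on `Γ₀`" over the whole hemisphere, POLES INCLUDED** — the second of the two facts H imports at l.5984–5988, now
without the restriction `sin θ ≠ 0` of module 76 `carterC_pos`; every real `a`, `μ > 0`. [cite: Hintz2026WavesII, Lemma 4.14 `LemmaTs3bOTrap0Reg` TeX l.4623, l.4637 (reproduced, poles included); Hintz2026, TeX l.5984-5988 (the import site)] -/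
theorem carterCpol_pos (hμ : 0 < mu m a r) (hu : normSq ω₁ ω₂ < 1) (hρ : 0 < rhoSq a r (normSq ω₁ ω₂)) (hξ : ξ = 0)
    (hG : G3bpol m a r ω₁ ω₂ σ ξ η₁ η₂ = 0) (hne : ¬(σ = 0 ∧ ξ = 0 ∧ η₁ = 0 ∧ η₂ = 0)) :
    0 < carterCpol a ω₁ ω₂ σ η₁ η₂ := by
  have hA := A_ne_zero_pol hu hρ hξ hG hne
  rw [carterCpol_eq_of_onSigma hξ hG]
  positivity

/-- (4.33) `μB² ≤ A²` in the polar chart (`B² ≤ |ω|²𝒞 ≤ 𝒞 = A²/μ`, `|ω|² ≤ 1`, `μ > 0`).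
[cite: Hintz2026WavesII, eq. (4.33) `EqTs3bOConvexEst` TeX l.4489-4492 ('μ⁻¹A² = 𝒞 ≥ B²'; reproduced, poles included)] -/
theorem mu_Bpol_sq_le_Asq (hμ : 0 < mu m a r) (hu : normSq ω₁ ω₂ ≤ 1) (hξ : ξ = 0)
    (hG : G3bpol m a r ω₁ ω₂ σ ξ η₁ η₂ = 0) :
    mu m a r * Bpol a ω₁ ω₂ σ η₁ η₂ ^ 2 ≤ Afn a r σ (Lpol ω₁ ω₂ η₁ η₂) ^ 2 := by
  have h1 := Bpol_sq_le_carterCpol a ω₁ ω₂ σ η₁ η₂ hu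
  have hC := carterCpol_eq_of_onSigma hξ hG
  have h2 : mu m a r * carterCpol a ω₁ ω₂ σ η₁ η₂ = Afn a r σ (Lpol ω₁ ω₂ η₁ η₂) ^ 2 := by
    rw [hC]; field_simp
  nlinarith [mul_le_mul_of_nonneg_left h1 hμ.le]

/-- The chart-free core of (4.41): from `μB² ≤ A²`, `A ≠ 0` and `(r²+a²)² − a²μ = r⁴ + a²r² + 2𝔪a²r > 0`:
`(μaAB)² < ((r²+a²)A²)²` (module 76 `pairing_key_sq`, with the bound `μB² ≤ A²` as the hypothesis). [cite: Hintz2026WavesII, TeX l.4598 (reproduced)] -/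
theorem pairing_key_sq_core {A B : ℝ} (hm : 0 < m) (hr : 0 < r) (hμ : 0 < mu m a r) (hA : A ≠ 0)
    (hB2 : mu m a r * B ^ 2 ≤ A ^ 2) :
    (mu m a r * a * A * B) ^ 2 < ((r ^ 2 + a ^ 2) * A ^ 2) ^ 2 := by
  have hA2 : 0 < A ^ 2 := by positivity
  have hkey : (r ^ 2 + a ^ 2) ^ 2 - a ^ 2 * mu m a r = r ^ 4 + a ^ 2 * r ^ 2 + 2 * m * a ^ 2 * r := by
    simp only [mu]; ring
  have hpos : 0 < r ^ 4 + a ^ 2 * r ^ 2 + 2 * m * a ^ 2 * r := by positivity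
  have step1 : (mu m a r * a * A * B) ^ 2 ≤ mu m a r * a ^ 2 * A ^ 2 * A ^ 2 := by
    have hid : (mu m a r * a * A * B) ^ 2 = mu m a r * a ^ 2 * A ^ 2 * (mu m a r * B ^ 2) := by ring
    rw [hid]
    exact mul_le_mul_of_nonneg_left hB2 (by positivity)
  have step2 : mu m a r * a ^ 2 * A ^ 2 * A ^ 2 < ((r ^ 2 + a ^ 2) * A ^ 2) ^ 2 := by
    have hid : ((r ^ 2 + a ^ 2) * A ^ 2) ^ 2 - mu m a r * a ^ 2 * A ^ 2 * A ^ 2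
        = (r ^ 4 + a ^ 2 * r ^ 2 + 2 * m * a ^ 2 * r) * (A ^ 2 * A ^ 2) := by
      rw [← hkey]; ring
    nlinarith [mul_pos hpos (mul_pos hA2 hA2)]
  exact lt_of_le_of_lt step1 step2

/-- The chart-free core of (4.41)–(4.42): with `u` the value of `sin²θ = |ω|²`, `L = η_ϕ`, `A = Afn a r σ L`, under the trapped
relation (4.35) `4rμσ + Aμ' = 0`, `A ≠ 0` and `μB² ≤ A²`: `σ·ϱ²g⁻¹(d𝔱,ζ) > 0` (`r > 𝔪 > 0`, `μ > 0`).
[cite: Hintz2026WavesII, eqs. (4.41)-(4.42) TeX l.4593-4603 (reproduced; module 76 `sigma_mul_dtPairing_pos` with its inputs as hypotheses)] -/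
theorem sigma_mul_dtPairing_pos_core {u L : ℝ} (hm : 0 < m) (hmr : m < r) (hμ : 0 < mu m a r)
    (hA : Afn a r σ L ≠ 0) (htr : 4 * r * mu m a r * σ + Afn a r σ L * dmu m r = 0)
    (hB2 : mu m a r * Bfn a u σ L ^ 2 ≤ Afn a r σ L ^ 2) :
    0 < σ * dtPairing m a r u σ L := by
  have hr : 0 < r := lt_trans hm hmr
  have hsq := pairing_key_sq_core (a := a) hm hr hμ hA hB2
  have hX : 0 < (r ^ 2 + a ^ 2) * Afn a r σ L ^ 2 := by positivity
  have hlt := (abs_lt_of_sq_lt_sq' hsq hX.le).2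
  have h4 : 4 * r * mu m a r * σ = -(Afn a r σ L * dmu m r) := by linarith
  have hdt := dtPairing_mul_mu (s2 := u) (σ := σ) (ηφ := L) hμ.ne'
  have hprod : σ * dtPairing m a r u σ L * (4 * r * mu m a r ^ 2)
      = dmu m r * ((r ^ 2 + a ^ 2) * Afn a r σ L ^ 2 - mu m a r * a * Afn a r σ L * Bfn a u σ L) := by
    have hre : σ * dtPairing m a r u σ L * (4 * r * mu m a r ^ 2)
        = (4 * r * mu m a r * σ) * (dtPairing m a r u σ L * mu m a r) := by ring
    rw [hre, h4, hdt]
    ring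
  have hdmu : 0 < dmu m r := by simp only [dmu]; linarith
  have hpos : 0 < dmu m r * ((r ^ 2 + a ^ 2) * Afn a r σ L ^ 2 - mu m a r * a * Afn a r σ L * Bfn a u σ L) :=
    mul_pos hdmu (by linarith)
  rw [← hprod] at hpos
  exact (mul_pos_iff_of_pos_right (by positivity : (0:ℝ) < 4 * r * mu m a r ^ 2)).mp hpos

/-- **(4.41)–(4.42) over the whole hemisphere, poles included: `σ·ϱ²g⁻¹(d𝔱,ζ) > 0` on `Γ₀ ∖ o`** (`|ω|² < 1`, `μ > 0`, `r > 𝔪 > 0`,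
every real `a`; `ϱ²g⁻¹(d𝔱,ζ)` = module 76's `dtPairing` at `s2 = |ω|²`, `η_ϕ = ω¹η₂ − ω²η₁`). [cite: Hintz2026WavesII, eqs. (4.41)-(4.42) `EqTs3bOTrapSign`/`EqTs3bOSigmaSign` TeX l.4593-4603 (reproduced, poles included); Dyatlov2015, §3.2 (held text (e:houston) 'τ((r²+a²)τ + aξ_φ) > 0')] -/
theorem sigma_mul_dtPairing_pos_pol (hm : 0 < m) (hmr : m < r) (hμ : 0 < mu m a r) (hu : normSq ω₁ ω₂ < 1)
    (h0 : OnGamma0Pol m a r ω₁ ω₂ σ ξ η₁ η₂) (hne : ¬(σ = 0 ∧ ξ = 0 ∧ η₁ = 0 ∧ η₂ = 0)) :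
    0 < σ * dtPairing m a r (normSq ω₁ ω₂) σ (Lpol ω₁ ω₂ η₁ η₂) := by
  obtain ⟨hξ, hΨ, hG⟩ := h0
  have hρ := rhoSq_pol_pos (a := a) hu (by linarith : r ≠ 0)
  have hA := A_ne_zero_pol hu hρ hξ hG hne
  have hB2 := mu_Bpol_sq_le_Asq hμ hu.le hξ hG
  rw [Bpol_eq_Bfn] at hB2
  exact sigma_mul_dtPairing_pos_core hm hmr hμ hA (trapped_relation hΨ hA) hB2

/-- **`σ > 0` on the future half of `Γ₀`, poles included** (H l.7498's import; future half = module 76's `InSigmaPlus`, [AF] (4.11b)).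
[cite: Hintz2026WavesII, eq. (4.42) `EqTs3bOSigmaSign` TeX l.4599-4603 (reproduced, poles included); Hintz2026, TeX l.7498 (the import site)] -/
theorem sigma_pos_pol (hm : 0 < m) (hmr : m < r) (hμ : 0 < mu m a r) (hu : normSq ω₁ ω₂ < 1)
    (h0 : OnGamma0Pol m a r ω₁ ω₂ σ ξ η₁ η₂) (hne : ¬(σ = 0 ∧ ξ = 0 ∧ η₁ = 0 ∧ η₂ = 0)) :
    InSigmaPlus m a r (normSq ω₁ ω₂) σ (Lpol ω₁ ω₂ η₁ η₂) ↔ 0 < σ := by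
  have h := sigma_mul_dtPairing_pos_pol hm hmr hμ hu h0 hne
  unfold InSigmaPlus
  constructor
  · intro hplus
    rcases pos_and_pos_or_neg_and_neg_of_mul_pos h with ⟨hσ, -⟩ | ⟨-, hd⟩
    · exact hσ
    · exact absurd hplus (not_lt.mpr hd.le)
  · intro hσ
    rcases pos_and_pos_or_neg_and_neg_of_mul_pos h with ⟨-, hd⟩ | ⟨hσ', -⟩
    · exact hd
    · exact absurd hσ (not_lt.mpr hσ'.le)

/-- **The trapped relations over the whole hemisphere**: on `Γ₀ ∖ o`, `A(r − 𝔪) = −2rμσ` and `𝒞(r − 𝔪)² = 4r²μσ²` (module 76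
`trapped_relations`, poles included). [cite: Hintz2026WavesII, eq. (4.33) TeX l.4491 and eq. (4.35) TeX l.4547 (reproduced); Chandrasekhar1998, ch. 7 §63 eqs. (224)-(225)] -/
theorem trapped_relations_pol (hμ : 0 < mu m a r) (hu : normSq ω₁ ω₂ < 1) (hρ : 0 < rhoSq a r (normSq ω₁ ω₂))
    (h0 : OnGamma0Pol m a r ω₁ ω₂ σ ξ η₁ η₂) (hne : ¬(σ = 0 ∧ ξ = 0 ∧ η₁ = 0 ∧ η₂ = 0)) :
    Afn a r σ (Lpol ω₁ ω₂ η₁ η₂) * (r - m) = -(2 * r * mu m a r * σ) ∧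
      carterCpol a ω₁ ω₂ σ η₁ η₂ * (r - m) ^ 2 = 4 * r ^ 2 * mu m a r * σ ^ 2 := by
  obtain ⟨hξ, hΨ, hG⟩ := h0
  have hA := A_ne_zero_pol hu hρ hξ hG hne
  have htr := trapped_relation hΨ hA
  simp only [dmu] at htr
  have h1 : Afn a r σ (Lpol ω₁ ω₂ η₁ η₂) * (r - m) = -(2 * r * mu m a r * σ) := by
    linear_combination (1 / 2 : ℝ) * htr
  refine ⟨h1, ?_⟩
  have hsq : (Afn a r σ (Lpol ω₁ ω₂ η₁ η₂) * (r - m)) ^ 2 = (2 * r * mu m a r * σ) ^ 2 := by rw [h1]; ring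
  rw [carterCpol_eq_of_onSigma hξ hG]
  field_simp
  linear_combination hsq

/-- The polar `window_key`: `a²(r−𝔪)²(|ω|²·𝒞 − B²) = −σ²f(|ω|²)` on `Γ₀` (module 76 `fq`). [cite: Chandrasekhar1998, ch. 7 §63 eqs. (224)-(228) (computed here in the polar chart)] -/
theorem window_key_pol (h1 : Afn a r σ (Lpol ω₁ ω₂ η₁ η₂) * (r - m) = -(2 * r * mu m a r * σ))
    (h2 : carterCpol a ω₁ ω₂ σ η₁ η₂ * (r - m) ^ 2 = 4 * r ^ 2 * mu m a r * σ ^ 2) :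
    a ^ 2 * (r - m) ^ 2 * (normSq ω₁ ω₂ * carterCpol a ω₁ ω₂ σ η₁ η₂ - Bpol a ω₁ ω₂ σ η₁ η₂ ^ 2)
      = -(σ ^ 2 * fq m a r (normSq ω₁ ω₂)) := by
  have e1 : a * Bpol a ω₁ ω₂ σ η₁ η₂ = Afn a r σ (Lpol ω₁ ω₂ η₁ η₂) + rhoSq a r (normSq ω₁ ω₂) * σ := by
    linarith [rhoSq_mul_sigma_pol a ω₁ ω₂ σ η₁ η₂ r]
  have e2 : (a * Bpol a ω₁ ω₂ σ η₁ η₂ * (r - m)) ^ 2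
      = (rhoSq a r (normSq ω₁ ω₂) * σ * (r - m) - 2 * r * mu m a r * σ) ^ 2 := by
    rw [e1]
    congr 1
    linear_combination h1
  have e3 : a ^ 2 * (r - m) ^ 2 * (normSq ω₁ ω₂ * carterCpol a ω₁ ω₂ σ η₁ η₂)
      = a ^ 2 * normSq ω₁ ω₂ * (4 * r ^ 2 * mu m a r * σ ^ 2) := by
    rw [← h2]; ring
  unfold fq
  linear_combination e3 - e2

/-- **The photon-orbit cubic is `≤ 0` on `Γ₀ ∖ o` over the whole hemisphere, poles included** (`|a| < 𝔪` as `a² = 𝔪² − s²`, `s > 0`;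
`r > r₊ = 𝔪 + s`; `|ω|² < 1`): the `θ`-constraint is now `|ω|²𝒞 − B² = (1 − |ω|²)(ω·η)² ≥ 0`. [cite: Chandrasekhar1998, ch. 7 §63 eqs. (226)-(228) (verified here, polar chart); Hintz2026WavesII, Def. 4.13 TeX l.4607-4613] -/
theorem photonCubic_nonpos_pol (hm : 0 < m) (hs : 0 < s) (has : s ^ 2 + a ^ 2 = m ^ 2) (hr : m + s < r)
    (hu : normSq ω₁ ω₂ < 1) (h0 : OnGamma0Pol m a r ω₁ ω₂ σ ξ η₁ η₂) (hne : ¬(σ = 0 ∧ ξ = 0 ∧ η₁ = 0 ∧ η₂ = 0)) :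
    photonCubic m a r ≤ 0 := by
  have hμeq := mu_eq_sq_sub (r := r) has
  have hmr : m < r := by linarith
  have hr0 : 0 < r := by linarith
  have hμ : 0 < mu m a r := by
    rw [hμeq]; nlinarith [mul_pos (by linarith : 0 < r - m - s) (by linarith : 0 < r - m + s)]
  have hρ := rhoSq_pol_pos (a := a) hu hr0.ne'
  obtain ⟨h1, h2⟩ := trapped_relations_pol hμ hu hρ h0 hne
  have hA := A_ne_zero_pol hu hρ h0.1 h0.2.2 hne
  have hσ := sigma_ne_zero hmr h0.2.1 hA
  have key := window_key_pol h1 h2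
  have hCB : 0 ≤ normSq ω₁ ω₂ * carterCpol a ω₁ ω₂ σ η₁ η₂ - Bpol a ω₁ ω₂ σ η₁ η₂ ^ 2 := by
    rw [normSq_mul_carterCpol]
    nlinarith [mul_nonneg (sub_nonneg.mpr hu.le) (sq_nonneg (ω₁ * η₁ + ω₂ * η₂))]
  have hnn : 0 ≤ a ^ 2 * (r - m) ^ 2 * (normSq ω₁ ω₂ * carterCpol a ω₁ ω₂ σ η₁ η₂ - Bpol a ω₁ ω₂ σ η₁ η₂ ^ 2) :=
    mul_nonneg (mul_nonneg (sq_nonneg a) (sq_nonneg (r - m))) hCB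
  have hf : σ ^ 2 * fq m a r (normSq ω₁ ω₂) ≤ 0 := by linarith
  have hm2r : m ^ 2 < r ^ 2 := by nlinarith
  have hμ2 : mu m a r ≤ 2 * r ^ 2 := by simp only [mu]; nlinarith
  have hf1 := fq_one_le (m := m) (a := a) (r := r) (normSq ω₁ ω₂) hu.le hμ.le hμ2 hr0.le
  rw [fq_one] at hf1
  have hσ2 : 0 < σ ^ 2 := by positivity
  have h3 : σ ^ 2 * (r ^ 3 * photonCubic m a r) ≤ σ ^ 2 * 0 := by rw [mul_zero]; nlinarith
  have h4 : r ^ 3 * photonCubic m a r ≤ 0 := le_of_mul_le_mul_left h3 hσ2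
  have h5 : r ^ 3 * photonCubic m a r ≤ r ^ 3 * 0 := by rw [mul_zero]; exact h4
  exact le_of_mul_le_mul_left h5 (pow_pos hr0 3)

/-- **(4.43) in its SHARP form over the whole hemisphere, poles included: `r_ph⁺ ≤ r ≤ r_ph⁻` on `Γ₀ ∖ o`** (`a² = 𝔪² − s²`, `s > 0`,
`r > r₊`, `|ω|² < 1`; the tree's `Kerr.photonOrbitRadius M (∓|a|)`), with module 76's explicit enclosures
`r₊ + s²/(3𝔪) ≤ r_ph⁺ ≤ 3𝔪 ≤ r_ph⁻ ≤ 4𝔪` (`shell_bounds`) — the first of the two facts H imports at l.5982–5983, now on all of `Γ₀`.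
[cite: Hintz2026WavesII, eq. (4.43) `EqTs3bOTrap0Cpt` TeX l.4615-4619 (sharp form, poles included); Hintz2026, TeX l.5982-5983 (the import site); Teo2003, §2; BardeenPressTeukolsky1972, (2.18)] -/
theorem trapped_radius_shell_pol (hm : 0 < m) (hs : 0 < s) (has : s ^ 2 + a ^ 2 = m ^ 2) (hr : m + s < r)
    (hu : normSq ω₁ ω₂ < 1) (h0 : OnGamma0Pol m a r ω₁ ω₂ σ ξ η₁ η₂) (hne : ¬(σ = 0 ∧ ξ = 0 ∧ η₁ = 0 ∧ η₂ = 0)) :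
    Kerr.photonOrbitRadius m (-|a|) ≤ r ∧ r ≤ Kerr.photonOrbitRadius m |a| := by
  have hp := photonCubic_nonpos_pol hm hs has hr hu h0 hne
  simp only [photonCubic] at hp
  have ha := (abs_a_lt hm hs has).1
  have hmr : m < r := by linarith
  refine ⟨?_, ?_⟩
  · by_contra hc
    have h := Kerr.photonCubic_pos_of_lt_photonOrbitRadius_neg hm ha hmr (not_le.mp hc)
    linarith
  · by_contra hc
    have h := Kerr.photonCubic_pos_of_photonOrbitRadius_lt hm ha.le (not_le.mp hc)
    linarith

/-- **(4.44) over the whole hemisphere, poles included**: the Jacobian `∂(ξ,Ψ,G_3b)/∂(ξ,r,σ)` — module 76's `jac` at `s2 = |ω|²`,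
`η_ϕ = ω¹η₂ − ω²η₁`, whose `∂_σ`-entry `−2ϱ²g⁻¹(d𝔱,·)` IS `∂_σ` of the polar `G_3b` (engine A1.13) — has `det ≠ 0` on `Γ₀ ∖ o`
(`r > 𝔪 > 0`, `a² ≤ 𝔪²`, `μ > 0`, `|ω|² < 1`). [cite: Hintz2026WavesII, eq. (4.44) `EqTs3bOTrap0RegDiff` and Lemma 4.14 TeX l.4621-4638 (reproduced, poles included)] -/
theorem jac_det_ne_zero_pol (hm : 0 < m) (hmr : m < r) (ha : a ^ 2 ≤ m ^ 2) (hμ : 0 < mu m a r) (hu : normSq ω₁ ω₂ < 1)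
    (h0 : OnGamma0Pol m a r ω₁ ω₂ σ ξ η₁ η₂) (hne : ¬(σ = 0 ∧ ξ = 0 ∧ η₁ = 0 ∧ η₂ = 0)) :
    (jac m a r (normSq ω₁ ω₂) σ ξ (Lpol ω₁ ω₂ η₁ η₂)).det ≠ 0 := by
  obtain ⟨hξ, hΨ, hG⟩ := h0
  rw [jac_det m a r _ σ ξ _ hξ hΨ]
  have hρ := rhoSq_pol_pos (a := a) hu (by linarith : r ≠ 0)
  have hA := A_ne_zero_pol hu hρ hξ hG hne
  have h1 := dPsi_pos m a r σ (Afn a r σ (Lpol ω₁ ω₂ η₁ η₂)) hm.le hmr ha hμ hA (trapped_relation hΨ hA)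
  have h2 := sigma_mul_dtPairing_pos_pol hm hmr hμ hu ⟨hξ, hΨ, hG⟩ hne
  have h3 : dtPairing m a r (normSq ω₁ ω₂) σ (Lpol ω₁ ω₂ η₁ η₂) ≠ 0 := fun h => by
    rw [h, mul_zero] at h2; exact lt_irrefl 0 h2
  exact mul_ne_zero h1.ne' (neg_ne_zero.mpr (mul_ne_zero two_ne_zero h3))

/-- The certified `σ`-partial of the polar `G_3b`: `∂_σG_3b = 2(r²+a²)A/μ − 2aB = −2ϱ²g⁻¹(d𝔱,ζ)` for EVERY `ω` (poles included),
justifying the use of module 76's `jac` above. [cite: Hintz2026WavesII, eq. (4.44) TeX l.4632 ('∂_σG_3b = −2ϱ²g⁻¹(d𝔱,·)'; reproduced in the polar chart)] -/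
theorem hasDerivAt_G3bpol_sigma :
    HasDerivAt (fun x => G3bpol m a r ω₁ ω₂ x ξ η₁ η₂)
      (-(2 * dtPairing m a r (normSq ω₁ ω₂) σ (Lpol ω₁ ω₂ η₁ η₂))) σ := by
  unfold G3bpol carterCpol
  have hC : HasDerivAt (fun x => (η₁ + a * x * ω₂) ^ 2 + (η₂ - a * x * ω₁) ^ 2 - (ω₁ * η₁ + ω₂ * η₂) ^ 2)
      (2 * (η₁ + a * σ * ω₂) * (a * ω₂) + 2 * (η₂ - a * σ * ω₁) * (-(a * ω₁))) σ := by
    have h1 : HasDerivAt (fun x => η₁ + a * x * ω₂) (a * ω₂) σ := by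
      simpa using (((hasDerivAt_id' σ).const_mul a).mul_const ω₂).const_add η₁
    have h2 : HasDerivAt (fun x => η₂ - a * x * ω₁) (-(a * ω₁)) σ := by
      simpa using (((hasDerivAt_id' σ).const_mul a).mul_const ω₁).const_sub η₂
    exact ((h1.fun_pow 2).fun_add (h2.fun_pow 2)).fun_sub (hasDerivAt_const σ _) |>.congr_deriv (by ring)
  exact ((hasDerivAt_sG_sigma m a r σ ξ (Lpol ω₁ ω₂ η₁ η₂)).fun_add hC).congr_deriv
    (by simp only [dtPairing, Bfn, Lpol, normSq, Afn]; ring)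

/-! ### 2a. AT A POLE (`ω = 0`): `η ≠ 0` and the polar photon orbit -/

/-- AT A POLE: `G_3b = μξ² − (r²+a²)²σ²/μ + (η₁² + η₂²)` (`η_ϕ = 0`, `A = −(r²+a²)σ`). [cite: Hintz2026WavesII, eq. (4.32) with (4.22) at ω = 0 (computed here)] -/
theorem G3bpol_at_pole :
    G3bpol m a r 0 0 σ ξ η₁ η₂ = mu m a r * ξ ^ 2 - ((r ^ 2 + a ^ 2) * σ) ^ 2 / mu m a r + (η₁ ^ 2 + η₂ ^ 2) := by
  simp only [G3bpol, sG, Vfn, Afn, Lpol, carterCpol_at_pole]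
  ring

/-- **"`η = (η₁,η₂) ≠ 0` … (this follows from … the fact that `d𝔱` is not null)"** ([AF] l.4921) / Dyatlov's "`|∂_{ξ₁}G| + |∂_{ξ₂}G| > 0`
at the poles" (`∂_{η_i}𝒞 = 2η_i` there): at a pole point of `{ξ = 0} ∩ Σ ∖ o` (`μ > 0`), `η ≠ 0` — for `η = 0` would leave the
covector `−σd𝔱` with `G_3b(−σd𝔱) = −(r²+a²)²σ²/μ = 0`, i.e. `σ = 0`. [cite: Hintz2026WavesII, TeX l.4919-4921 (reproduced); Dyatlov2015, §3.2 (held text p.16: '|∂_{ξ₁}G| + |∂_{ξ₂}G| > 0 … as ξ₁ = ξ₂ = 0 would imply G_θ = 0, which is impossible given that ξ_r = 0, G = 0, and ξ̃ ≠ 0')] -/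
theorem eta_ne_zero_at_pole (hμ : 0 < mu m a r) (hr : r ≠ 0) (hξ : ξ = 0) (hG : G3bpol m a r 0 0 σ ξ η₁ η₂ = 0)
    (hne : ¬(σ = 0 ∧ ξ = 0 ∧ η₁ = 0 ∧ η₂ = 0)) : ¬(η₁ = 0 ∧ η₂ = 0) := by
  rintro ⟨h1, h2⟩
  apply hne
  subst hξ h1 h2
  rw [G3bpol_at_pole] at hG
  have hra : 0 < r ^ 2 + a ^ 2 := by positivity
  have h : ((r ^ 2 + a ^ 2) * σ) ^ 2 / mu m a r = 0 := by linarith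
  rcases div_eq_zero_iff.mp h with h | h
  · have := (pow_eq_zero_iff two_ne_zero).mp h
    rcases mul_eq_zero.mp this with h' | h'
    · exact absurd h' hra.ne'
    · exact ⟨h', rfl, rfl, rfl⟩
  · exact absurd h hμ.ne'

/-- AT A POLE the trapped relation (4.35) `4rμσ + Aμ' = 0` with `A = −(r²+a²)σ`, `σ ≠ 0` is the POLAR PHOTON-ORBIT CUBIC
`r³ − 3𝔪r² + a²r + 𝔪a² = 0` (the `η_ϕ = 0` spherical orbit of the shell; Teo's `r₃`). [cite: Teo2003, §2 (the orbit with zero angular momentum Φ = 0); Hintz2026WavesII, eq. (4.35) TeX l.4547 at ω = 0 (computed here)] -/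
theorem polar_orbit_cubic (hσ : σ ≠ 0) (hΨ : Psi m a r σ (Lpol 0 0 η₁ η₂) = 0)
    (hA : Afn a r σ (Lpol 0 0 η₁ η₂) ≠ 0) :
    r ^ 3 - 3 * m * r ^ 2 + a ^ 2 * r + m * a ^ 2 = 0 := by
  have h := trapped_relation hΨ hA
  simp only [Afn, Lpol, dmu, mu] at h
  have h' : σ * (2 * (r ^ 3 - 3 * m * r ^ 2 + a ^ 2 * r + m * a ^ 2)) = 0 := by linear_combination h
  rcases mul_eq_zero.mp h' with h | h
  · exact absurd h hσ
  · linarith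

/-- AT A POLE on `Γ₀ ∖ o`: `𝒞 = η₁² + η₂² = (r²+a²)²σ²/μ` and the polar cubic holds; in Schwarzschild (`a = 0`) this is `r = 3𝔪`,
`|η|² = 27𝔪²σ²`, consistent with module 76 `schwarzschild_photon_sphere`. [cite: Hintz2026WavesII, Def. 4.13 at ω = 0 (computed here); Dyatlov2015, §3.3 Prop. 3.8] -/
theorem pole_point_summary (hμ : 0 < mu m a r) (hr : r ≠ 0) (h0 : OnGamma0Pol m a r 0 0 σ ξ η₁ η₂)
    (hne : ¬(σ = 0 ∧ ξ = 0 ∧ η₁ = 0 ∧ η₂ = 0)) :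
    η₁ ^ 2 + η₂ ^ 2 = ((r ^ 2 + a ^ 2) * σ) ^ 2 / mu m a r ∧ σ ≠ 0 ∧
      r ^ 3 - 3 * m * r ^ 2 + a ^ 2 * r + m * a ^ 2 = 0 := by
  obtain ⟨hξ, hΨ, hG⟩ := h0
  have hη := eta_ne_zero_at_pole hμ hr hξ hG hne
  have hC := carterCpol_eq_of_onSigma hξ hG
  rw [carterCpol_at_pole] at hC
  have hC' : η₁ ^ 2 + η₂ ^ 2 = ((r ^ 2 + a ^ 2) * σ) ^ 2 / mu m a r := by
    rw [hC]; simp [Afn, Lpol]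
  have hσ : σ ≠ 0 := by
    intro hσ
    apply hη
    rw [hσ] at hC'
    simp only [mul_zero, ne_eq, OfNat.ofNat_ne_zero, not_false_eq_true, zero_pow, zero_div] at hC'
    constructor <;> nlinarith [sq_nonneg η₁, sq_nonneg η₂]
  have hA : Afn a r σ (Lpol 0 0 η₁ η₂) ≠ 0 := by
    simp only [Afn, Lpol, mul_zero, sub_zero, add_zero, mul_comm, ne_eq, neg_eq_zero, mul_eq_zero, not_or]
    exact ⟨hσ, by positivity⟩
  exact ⟨hC', hσ, polar_orbit_cubic hσ hΨ hA⟩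

end Gamma0Polar

/-! ## 3. [AF] Lemma 4.18 `LemmaTs3bOnu`: the expansion rates (4.49)–(4.50), with Dyatlov's Schwarzschild value -/

section ExpansionRates

variable (m a r s2 σ ξ ηφ : ℝ)

/-- `∂_r²Φ` for `Φ = V + 𝒞` (only `V` depends on `r`): the certified second derivative `−∂_rΨ/μ² + 2Ψμ'/μ³` of module 76
(`hasDerivAt_dPhi`, the derivative of `∂_rΦ = ∂_rV = −Ψ/μ²` of `hasDerivAt_V`). [cite: Hintz2026WavesII, proof of Lemma 4.12 TeX l.4544-4549 and proof of Lemma 4.18 TeX l.4741 ('2μ⁻²∂_rΨ = 2∂_r(μ⁻²Ψ) = −2∂_r²V = −2∂_r²Φ⁰' at Ψ = 0; transcription of the certified value)] -/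
def d2Phi (m a r σ ηφ : ℝ) : ℝ :=
  -dPsiFormal m a r σ (Afn a r σ ηφ) / mu m a r ^ 2 + 2 * Psi m a r σ ηφ * dmu m r / mu m a r ^ 3

/-- `d2Phi` IS the second `r`-derivative of `Φ` (i.e. the derivative of `r ↦ −Ψ/μ² = ∂_rV`; `μ ≠ 0`).
[cite: Hintz2026WavesII, proof of Lemma 4.12 TeX l.4544-4549 (reproduced: module 76 `hasDerivAt_dPhi`)] -/
theorem hasDerivAt_dPhi_eq (hμ : mu m a r ≠ 0) :
    HasDerivAt (fun ρ => -Psi m a ρ σ ηφ / mu m a ρ ^ 2) (d2Phi m a r σ ηφ) r :=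
  hasDerivAt_dPhi m a r σ ηφ hμ

/-- The printed step "`H_{G_3b}(2ξ) = −2μ'ξ² + 2Ψ/μ²`" (twice module 76's `HGxi`). [cite: Hintz2026WavesII, proof of Lemma 4.18 TeX l.4730 (reproduced)] -/
theorem HG_two_xi : 2 * HGxi m a r σ ξ ηφ = -(2 * dmu m r * ξ ^ 2) + 2 * Psi m a r σ ηφ / mu m a r ^ 2 := by
  simp only [HGxi]; ring

/-- **(4.49) squared: `ν² := σ⁻²·(−2μ(r)·∂_r²Φ(r))`** (the expansion rate of `φ₀^{u/s}` under `σ⁻¹H_{G_3b}` at `Γ₀`; [AF] takes the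
square root). [cite: Hintz2026WavesII, Lemma 4.18 `LemmaTs3bOnu` eq. (4.49) `EqTs3bOnuExpr` TeX l.4709-4711 (transcription, squared); Dyatlov2015, §3.2 Prop. 3.7 (held text (e:tilde-nu) p.17: 'ν̃ = √(−2Δ_r∂_r²G_r)/|∂_τG|')] -/
def nuSq (m a r σ ηφ : ℝ) : ℝ := -(2 * mu m a r * d2Phi m a r σ ηφ) / σ ^ 2

/-- At `Γ₀` (`Ψ = 0`): `ν² = 2∂_rΨ/(μσ²)` — the printed assembly "`2μ⁻²∂_rΨ = 2∂_r(μ⁻²Ψ) = −2∂_r²V = −2∂_r²Φ⁰`" (`μ, σ ≠ 0`).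
[cite: Hintz2026WavesII, proof of Lemma 4.18 TeX l.4744-4747 (reproduced)] -/
theorem nuSq_eq (hμ : mu m a r ≠ 0) (hσ : σ ≠ 0) (hΨ : Psi m a r σ ηφ = 0) :
    nuSq m a r σ ηφ = 2 * dPsiFormal m a r σ (Afn a r σ ηφ) / (mu m a r * σ ^ 2) := by
  unfold nuSq d2Phi
  rw [hΨ]
  field_simp
  ring

/-- **(4.50), pointwise: `ν² > 0` at every point of `Γ₀ ∖ o`** — for `r > 𝔪 ≥ 0`, `a² ≤ 𝔪²` (extremal INCLUDED), `μ > 0`, `A ≠ 0`,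
`σ ≠ 0` (both hold on `Γ₀ ∖ o`: modules 76/§2); by Lemma 4.12's `∂_rΨ > 0` (module 76 `dPsi_pos`).  [AF]'s `ν_min > 0` is the infimum
of this positive continuous degree-0 function over the compact quotient of `Γ₀` (compactness: (4.43), module 76) — the infimum
itself is not typed here. [cite: Hintz2026WavesII, Lemma 4.18 eq. (4.50) `EqTs3bOnuMin` TeX l.4712-4716 (pointwise content reproduced); Hintz2026WavesII, Def. 5.8 `DefSSTrapAdm` TeX l.5309-5317 (where ν_min > 0 is consumed); Hintz2026, Prop. 8.3 `PropWETr` TeX l.7395-7403] -/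
theorem nuSq_pos (hm : 0 ≤ m) (hmr : m < r) (ha : a ^ 2 ≤ m ^ 2) (hμ : 0 < mu m a r) (hσ : σ ≠ 0)
    (hΨ : Psi m a r σ ηφ = 0) (hA : Afn a r σ ηφ ≠ 0) : 0 < nuSq m a r σ ηφ := by
  rw [nuSq_eq m a r σ ηφ hμ.ne' hσ hΨ]
  have h := dPsi_pos m a r σ (Afn a r σ ηφ) hm hmr ha hμ hA (trapped_relation hΨ hA)
  positivity

/-- **The closed form on `Γ₀`: `ν² = 16r((r−𝔪)³ + 𝔪(𝔪²−a²))/(r−𝔪)²`** — by (4.36) `∂_rΨ = (2A²/(rμ))((r−𝔪)³ + 𝔪(𝔪²−a²))` and (4.35)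
`A(r−𝔪) = −2rμσ`; `σ` AND ALL ANGULAR DATA DROP OUT: the rate depends only on the orbit radius `r = r'_{(z,ζ)}` (`r ≠ 𝔪`, `r, μ, σ ≠ 0`).
[cite: Hintz2026WavesII, Lemma 4.18 eq. (4.49) with (4.35)-(4.36) TeX l.4545-4557, l.4709 (closed form computed here)] -/
theorem nuSq_closed_form (hr : r ≠ 0) (hrm : r ≠ m) (hμ : mu m a r ≠ 0) (hσ : σ ≠ 0) (hΨ : Psi m a r σ ηφ = 0)
    (hA : Afn a r σ ηφ ≠ 0) :
    nuSq m a r σ ηφ = 16 * r * ((r - m) ^ 3 + m * (m ^ 2 - a ^ 2)) / (r - m) ^ 2 := by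
  have htr := trapped_relation hΨ hA
  rw [nuSq_eq m a r σ ηφ hμ hσ hΨ, dPsi_at_trapped' m a r σ (Afn a r σ ηφ) htr hr hμ]
  have hrm' : r - m ≠ 0 := sub_ne_zero.mpr hrm
  have hAe : Afn a r σ ηφ = -(2 * r * mu m a r * σ) / (r - m) := by
    field_simp
    simp only [dmu] at htr
    linear_combination (1 / 2 : ℝ) * htr
  rw [hAe]
  field_simp
  ring

/-- |a|-DATUM: at `a² = 𝔪²` the closed form is `16r(r − 𝔪)`, which tends to `0` as the orbit radius `r → 𝔪` (the extremal prograde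
photon orbit sits at `r = 𝔪 = r₊`): (4.50) holds for each subextremal `a` but NOT uniformly up to extremality.
[cite: Dyatlov2015, §3.3 Prop. 3.9 (held text p.4 'ν_min converges to zero' as a → M, and Prop. 2.9 p.18); Hintz2026WavesII, eq. (4.50) TeX l.4714 (scope computed here)] -/
theorem nuSq_closed_form_extremal (ha : a ^ 2 = m ^ 2) (hrm : r ≠ m) :
    16 * r * ((r - m) ^ 3 + m * (m ^ 2 - a ^ 2)) / (r - m) ^ 2 = 16 * r * (r - m) := by
  have hrm' : r - m ≠ 0 := sub_ne_zero.mpr hrm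
  rw [ha, sub_self, mul_zero, add_zero]
  field_simp

/-- The closed form is positive for `r > 𝔪 ≥ 0`, `a² ≤ 𝔪²` (extremal included, pointwise). [cite: Hintz2026WavesII, eq. (4.50) TeX l.4714 (reproduced, closed form)] -/
theorem nuSq_closed_form_pos (hm : 0 ≤ m) (hmr : m < r) (ha : a ^ 2 ≤ m ^ 2) :
    0 < 16 * r * ((r - m) ^ 3 + m * (m ^ 2 - a ^ 2)) / (r - m) ^ 2 := by
  have hr : 0 < r := lt_of_le_of_lt hm hmr
  have h1 : 0 < (r - m) ^ 3 + m * (m ^ 2 - a ^ 2) := by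
    have : 0 < (r - m) ^ 3 := pow_pos (by linarith) 3
    nlinarith
  have h2 : 0 < (r - m) ^ 2 := pow_pos (by linarith) 2
  positivity

/-- **`H_{G_3b}𝔱 = 2ϱ²g⁻¹(d𝔱,·)`** ([AF] l.4758), i.e. `H_{G_3b}𝔱 = ∂_{ζ_𝔱}G_3b = −∂_σG_3b` for the covector `−σd𝔱 + …`; module 76
certifies `∂_σG_3b = −2ϱ²g⁻¹(d𝔱,ζ)` (`hasDerivAt_G3b_sigma`, and §2 `hasDerivAt_G3bpol_sigma` in the polar chart). [cite: Hintz2026WavesII, TeX l.4758 (transcription; the derivative is module 76's)] -/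
def HGt (m a r s2 σ ηφ : ℝ) : ℝ := 2 * dtPairing m a r s2 σ ηφ

/-- `∂_σG_3b = −H_{G_3b}𝔱` (`sin θ ≠ 0`; the polar version is `hasDerivAt_G3bpol_sigma`). [cite: Hintz2026WavesII, TeX l.4758 with eq. (4.44) l.4632 (reproduced)] -/
theorem hasDerivAt_G3b_sigma_HGt (ηθ : ℝ) (hs : s2 ≠ 0) :
    HasDerivAt (fun x => G3b m a r s2 x ξ ηθ ηφ) (-HGt m a r s2 σ ηφ) σ :=
  hasDerivAt_G3b_sigma m a r s2 σ ξ ηθ ηφ hs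

/-- **The `𝔱`-normalised rate** of `𝖧 = H_{G_3b}/(H_{G_3b}𝔱)`: `ν̃ = (σ/(H_{G_3b}𝔱))·ν` ([AF] l.4863 "`ν̃^{u/s} = (σ/(H_{G_3b}𝔱))ν^{s/u} > 0`"),
here squared: `ν̃² = σ²ν²/(H_{G_3b}𝔱)²` = Dyatlov's `ν̃² = −2Δ_r∂_r²G_r/(∂_τG)²`. [cite: Hintz2026WavesII, proof of Prop. 4.19(2) TeX l.4856-4863 (transcription, squared); Dyatlov2015, §3.2 Prop. 3.7 (held text (e:tilde-nu) p.17)] -/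
def nuNormSq (m a r s2 σ ηφ : ℝ) : ℝ := σ ^ 2 * nuSq m a r σ ηφ / HGt m a r s2 σ ηφ ^ 2

/-- `ν̃² > 0` wherever `ν² > 0`, `σ ≠ 0` and `ϱ²g⁻¹(d𝔱,ζ) ≠ 0` (all three hold on `Γ₀ ∖ o`: `nuSq_pos`, module 76 `sigma_ne_zero`,
`sigma_mul_dtPairing_pos`). [cite: Hintz2026WavesII, TeX l.4863 ('> 0'; reproduced)] -/
theorem nuNormSq_pos_of (hν : 0 < nuSq m a r σ ηφ) (hσ : σ ≠ 0) (hd : dtPairing m a r s2 σ ηφ ≠ 0) :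
    0 < nuNormSq m a r s2 σ ηφ := by
  unfold nuNormSq HGt
  have h1 : 0 < σ ^ 2 := by positivity
  have h2 : 0 < (2 * dtPairing m a r s2 σ ηφ) ^ 2 := by positivity
  positivity

/-- **`ν̃² > 0` on `Γ₀ ∖ o`** (BL chart of module 76: `r > 𝔪 > 0`, `a² ≤ 𝔪²`, `μ > 0`, `0 < sin²θ ≤ 1`, `ϱ² > 0`).
[cite: Hintz2026WavesII, Lemma 4.18 eq. (4.50) and TeX l.4863 (reproduced pointwise); Dyatlov2015, §3.2 Prop. 3.7 ('ν̃ > 0')] -/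
theorem nuNormSq_pos {m a r s2 σ ξ ηθ ηφ : ℝ} (hm : 0 < m) (hmr : m < r) (ha : a ^ 2 ≤ m ^ 2) (hμ : 0 < mu m a r)
    (hs : 0 < s2) (hs1 : s2 ≤ 1) (hρ : 0 < rhoSq a r s2) (h0 : OnGamma0 m a r s2 σ ξ ηθ ηφ)
    (hne : ¬(σ = 0 ∧ ξ = 0 ∧ ηθ = 0 ∧ ηφ = 0)) : 0 < nuNormSq m a r s2 σ ηφ := by
  obtain ⟨hξ, hΨ, hG⟩ := h0
  have hA := A_ne_zero hs hρ hξ hG hne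
  have hσ := sigma_ne_zero hmr hΨ hA
  have h := sigma_mul_dtPairing_pos hm hmr hμ hs hs1 hρ ⟨hξ, hΨ, hG⟩ hne
  have hd : dtPairing m a r s2 σ ηφ ≠ 0 := fun h0 => by rw [h0, mul_zero] at h; exact lt_irrefl 0 h
  exact nuNormSq_pos_of m a r s2 σ ηφ (nuSq_pos m a r σ ηφ hm.le hmr ha hμ hσ hΨ hA) hσ hd

/-- `ν̃² > 0` on `Γ₀ ∖ o` over the whole hemisphere in the polar chart, poles included (`|ω|² < 1`).
[cite: Hintz2026WavesII, Lemma 4.18 eq. (4.50) and TeX l.4863 (reproduced pointwise, poles included)] -/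
theorem nuNormSq_pos_pol {m a r σ ξ ω₁ ω₂ η₁ η₂ : ℝ} (hm : 0 < m) (hmr : m < r) (ha : a ^ 2 ≤ m ^ 2) (hμ : 0 < mu m a r)
    (hu : normSq ω₁ ω₂ < 1) (h0 : OnGamma0Pol m a r ω₁ ω₂ σ ξ η₁ η₂) (hne : ¬(σ = 0 ∧ ξ = 0 ∧ η₁ = 0 ∧ η₂ = 0)) :
    0 < nuNormSq m a r (normSq ω₁ ω₂) σ (Lpol ω₁ ω₂ η₁ η₂) := by
  obtain ⟨hξ, hΨ, hG⟩ := h0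
  have hρ := rhoSq_pol_pos (a := a) hu (by linarith : r ≠ 0)
  have hA := A_ne_zero_pol hu hρ hξ hG hne
  have hσ := sigma_ne_zero hmr hΨ hA
  have h := sigma_mul_dtPairing_pos_pol hm hmr hμ hu ⟨hξ, hΨ, hG⟩ hne
  have hd : dtPairing m a r (normSq ω₁ ω₂) σ (Lpol ω₁ ω₂ η₁ η₂) ≠ 0 := fun h0 => by
    rw [h0, mul_zero] at h; exact lt_irrefl 0 h
  exact nuNormSq_pos_of m a r _ σ _ (nuSq_pos m a r σ _ hm.le hmr ha hμ hσ hΨ hA) hσ hd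

/-! ### 3a. Schwarzschild: `r = 3𝔪`, `∂_r²Φ = −18σ²`, `ν² = 108𝔪²`, `ϱ²g⁻¹(d𝔱,ζ) = 27𝔪²σ`, `ν̃² = 1/(27𝔪²)` -/

/-- Schwarzschild, at the photon sphere `r = 3𝔪` (any `σ, η_ϕ`): `Ψ = 0` (the trapped relation holds identically: `4·3𝔪·3𝔪²σ = 9𝔪²σ·4𝔪`).
[cite: Dyatlov2015, §3.3 Prop. 3.8 (held text Prop. 2.8 p.18: 'Ψ(r) = 2τr²(r − 3M)', 'Ψ = 0 is equivalent to r = 3M'); Hintz2026WavesII, TeX l.4879] -/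
theorem Psi_schwarzschild : Psi m 0 (3 * m) σ ηφ = 0 := by
  simp only [Psi, Afn, mu, dmu]; ring

/-- Schwarzschild: `∂_r²Φ = −18σ²` at `r = 3𝔪` (`𝔪 ≠ 0`) — Dyatlov's "`∂_r²G_r = −18τ²/(1−9ΛM²)²`" at `Λ = 0`.
[cite: Dyatlov2015, §3.3 proof of Prop. 3.8 (held text p.18; reproduced at Λ = 0)] -/
theorem d2Phi_schwarzschild (hm : m ≠ 0) : d2Phi m 0 (3 * m) σ ηφ = -(18 * σ ^ 2) := by
  simp only [d2Phi, dPsiFormal, Psi, Afn, mu, dmu]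
  field_simp
  ring

/-- Schwarzschild: `ν² = 108𝔪²`, i.e. `ν = 6√3·𝔪` at `r = 3𝔪` (`𝔪, σ ≠ 0`). [cite: Hintz2026WavesII, eq. (4.49) TeX l.4709 (evaluated here); Dyatlov2015, §3.3 Prop. 3.8] -/
theorem nuSq_schwarzschild (hm : m ≠ 0) (hσ : σ ≠ 0) : nuSq m 0 (3 * m) σ ηφ = 108 * m ^ 2 := by
  unfold nuSq
  rw [d2Phi_schwarzschild m σ ηφ hm]
  simp only [mu]
  field_simp
  ring

/-- Schwarzschild: `ϱ²g⁻¹(d𝔱,ζ) = 27𝔪²σ` at `r = 3𝔪`, so `H_{G_3b}𝔱 = 54𝔪²σ` — Dyatlov's "`∂_τG = −54M²τ/(1−9ΛM²)`" at `Λ = 0`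
(`τ = −σ` is his `dt`-momentum). [cite: Dyatlov2015, §3.3 proof of Prop. 3.8 (held text p.18; reproduced at Λ = 0); Hintz2026WavesII, eq. (4.41) TeX l.4596] -/
theorem dtPairing_schwarzschild (hm : m ≠ 0) : dtPairing m 0 (3 * m) s2 σ ηφ = 27 * m ^ 2 * σ := by
  simp only [dtPairing, Afn, Bfn, mu]
  field_simp
  ring

/-- **Schwarzschild: `ν̃² = 1/(27𝔪²)`, i.e. `ν̃ = 1/(3√3𝔪)`** — Dyatlov's Prop. 3.8 "`ν̃ = √(1−9ΛM²)/(3√3M)`" at `Λ = 0` (the classical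
Lyapunov exponent of the photon sphere per unit static time), for every `σ ≠ 0`, `𝔪 ≠ 0` and any angular data.
[cite: Dyatlov2015, §3.3 Prop. 3.8 (held text Prop. 2.8 p.18, display (e:nu-sds); reproduced at Λ = 0); Hintz2026WavesII, Lemma 4.18 TeX l.4705-4717 with l.4863] -/
theorem nuNormSq_schwarzschild (hm : m ≠ 0) (hσ : σ ≠ 0) : nuNormSq m 0 (3 * m) s2 σ ηφ = 1 / (27 * m ^ 2) := by
  unfold nuNormSq HGt
  rw [nuSq_schwarzschild m σ ηφ hm hσ, dtPairing_schwarzschild m s2 σ ηφ hm]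
  field_simp
  ring

end ExpansionRates

/-! ## 4. [AF] Prop. 4.19(3) off the poles: the partials of `𝒞`, the degenerate locus, (4.61) and its homogenisation -/

section OffPoles

variable (a m r s2 σ ηθ ηφ θ : ℝ)

/-- `∂_{η_θ}𝒞 = 2η_θ`. [cite: Hintz2026WavesII, TeX l.4911 ('∂_{η_θ}𝒞₁ = 2η_θ'; reproduced) and eq. (4.62) ('∂_sθ = 2η_θ')] -/
theorem hasDerivAt_carterC_etatheta : HasDerivAt (fun x => carterC a s2 σ x ηφ) (2 * ηθ) ηθ := by
  unfold carterC
  exact (((hasDerivAt_id' ηθ).fun_pow 2).fun_add (hasDerivAt_const ηθ _)).congr_deriv (by simp)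

/-- `∂_{η_ϕ}𝒞 = 2(η_ϕ/sin²θ − aσ)` (`sin θ ≠ 0`; [AF] prints it at `σ = 1` as the first line of (4.62): "`∂_sϕ = 2(η_ϕ/sin²θ − a)`").
[cite: Hintz2026WavesII, eq. (4.62) `EqTs3bONHypFlow` TeX l.4929-4931 (reproduced, σ kept)] -/
theorem hasDerivAt_carterC_etaphi (hs : s2 ≠ 0) :
    HasDerivAt (fun x => carterC a s2 σ ηθ x) (2 * (ηφ / s2 - a * σ)) ηφ := by
  unfold carterC
  refine ((hasDerivAt_const ηφ (ηθ ^ 2)).fun_add ((hasDerivAt_const ηφ (1 / s2)).fun_mul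
    (((hasDerivAt_id' ηφ).const_add (-(a * s2 * σ))).fun_pow 2))).congr_deriv ?_
  field_simp
  ring

/-- The printed `θ`-partial: `∂_θ𝒞 = 2cot θ(a²σ²sin²θ − η_ϕ²/sin²θ)` ([AF] at `σ = 1`). [cite: Hintz2026WavesII, TeX l.4911 (transcription, σ kept)] -/
def dCarter_dtheta (a σ ηφ θ : ℝ) : ℝ :=
  2 * (Real.cos θ / Real.sin θ) * (a ^ 2 * σ ^ 2 * Real.sin θ ^ 2 - ηφ ^ 2 / Real.sin θ ^ 2)

/-- **`∂_θ𝒞 = 2cot θ(a²σ²sin²θ − η_ϕ²/sin²θ)`** for `𝒞(θ) = η_θ² + sin⁻²θ(−a sin²θ σ + η_ϕ)²` (`sin θ ≠ 0`).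
[cite: Hintz2026WavesII, TeX l.4911 (reproduced); Dyatlov2015, §3.2 (held text p.16, the display for ∂_θG at ξ_θ = 0, α = 0)] -/
theorem hasDerivAt_carterC_theta (hs : Real.sin θ ≠ 0) :
    HasDerivAt (fun t => carterC a (Real.sin t ^ 2) σ ηθ ηφ) (dCarter_dtheta a σ ηφ θ) θ := by
  unfold carterC dCarter_dtheta
  have h1 : HasDerivAt (fun t => Real.sin t ^ 2) (2 * Real.sin θ * Real.cos θ) θ :=
    ((Real.hasDerivAt_sin θ).fun_pow 2).congr_deriv (by norm_num)
  have hs2 : Real.sin θ ^ 2 ≠ 0 := pow_ne_zero 2 hs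
  have h2 : HasDerivAt (fun t => 1 / Real.sin t ^ 2) (-(2 * Real.sin θ * Real.cos θ) / (Real.sin θ ^ 2) ^ 2) θ :=
    ((hasDerivAt_const θ (1 : ℝ)).fun_div h1 hs2).congr_deriv (by ring)
  have h3 : HasDerivAt (fun t => (-(a * Real.sin t ^ 2 * σ) + ηφ) ^ 2)
      (2 * (-(a * Real.sin θ ^ 2 * σ) + ηφ) * (-(a * (2 * Real.sin θ * Real.cos θ) * σ))) θ := by
    have := (((h1.const_mul a).mul_const σ).fun_neg.add_const ηφ).fun_pow 2
    simpa using this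
  refine ((hasDerivAt_const θ (ηθ ^ 2)).fun_add (h2.fun_mul h3)).congr_deriv ?_
  field_simp
  ring

/-- The printed second `θ`-partial, in the raw quotient-rule form (its value at `θ = π/2` is what is used).
[cite: Hintz2026WavesII, TeX l.4944 ('∂_θ²𝒞₁'; computed here)] -/
def d2Carter (a σ ηφ θ : ℝ) : ℝ :=
  2 * (-(Real.sin θ * Real.sin θ + Real.cos θ * Real.cos θ) / Real.sin θ ^ 2)
      * (a ^ 2 * σ ^ 2 * Real.sin θ ^ 2 - ηφ ^ 2 / Real.sin θ ^ 2)
    + 2 * (Real.cos θ / Real.sin θ)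
      * (a ^ 2 * σ ^ 2 * (2 * Real.sin θ * Real.cos θ)
          + ηφ ^ 2 * (2 * Real.sin θ * Real.cos θ) / (Real.sin θ ^ 2) ^ 2)

/-- `∂_θ(∂_θ𝒞) = d2Carter` (`sin θ ≠ 0`). [cite: Hintz2026WavesII, TeX l.4944 (computed here)] -/
theorem hasDerivAt_dCarter_theta (hs : Real.sin θ ≠ 0) :
    HasDerivAt (fun t => dCarter_dtheta a σ ηφ t) (d2Carter a σ ηφ θ) θ := by
  unfold dCarter_dtheta d2Carter
  have h1 : HasDerivAt (fun t => Real.sin t ^ 2) (2 * Real.sin θ * Real.cos θ) θ :=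
    ((Real.hasDerivAt_sin θ).fun_pow 2).congr_deriv (by norm_num)
  have hs2 : Real.sin θ ^ 2 ≠ 0 := pow_ne_zero 2 hs
  have hcot : HasDerivAt (fun t => Real.cos t / Real.sin t)
      (-(Real.sin θ * Real.sin θ + Real.cos θ * Real.cos θ) / Real.sin θ ^ 2) θ :=
    ((Real.hasDerivAt_cos θ).fun_div (Real.hasDerivAt_sin θ) hs).congr_deriv (by ring)
  have h2 : HasDerivAt (fun t => ηφ ^ 2 / Real.sin t ^ 2)
      (-(ηφ ^ 2 * (2 * Real.sin θ * Real.cos θ)) / (Real.sin θ ^ 2) ^ 2) θ :=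
    ((hasDerivAt_const θ (ηφ ^ 2)).fun_div h1 hs2).congr_deriv (by ring)
  have h3 : HasDerivAt (fun t => a ^ 2 * σ ^ 2 * Real.sin t ^ 2 - ηφ ^ 2 / Real.sin t ^ 2)
      (a ^ 2 * σ ^ 2 * (2 * Real.sin θ * Real.cos θ)
        + ηφ ^ 2 * (2 * Real.sin θ * Real.cos θ) / (Real.sin θ ^ 2) ^ 2) θ := by
    refine ((h1.const_mul (a ^ 2 * σ ^ 2)).sub h2).congr_deriv ?_
    ring
  exact ((hcot.const_mul 2).mul h3).congr_deriv (by ring)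

/-- **`∂_θ²𝒞 = 2(η_ϕ² − a²σ²)` at `θ = π/2`** ([AF] l.4944 "`∂_θ²𝒞₁ = 2(η_ϕ² − a²)`"; Dyatlov "`∂_θ²G = 2(ξ_φ² − a²τ²)`").
[cite: Hintz2026WavesII, TeX l.4944 (reproduced); Dyatlov2015, §3.2 (held text p.16 display (e:kdstr-5) at α = 0)] -/
theorem d2Carter_equator : d2Carter a σ ηφ (Real.pi / 2) = 2 * (ηφ ^ 2 - a ^ 2 * σ ^ 2) := by
  simp [d2Carter, Real.sin_pi_div_two, Real.cos_pi_div_two]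
  ring

/-- The mixed partial `∂_{η_ϕ}∂_θ𝒞 = −4η_ϕ cos θ/sin³θ`. [cite: Hintz2026WavesII, TeX l.4936-4938 ('∂_{η_ϕ}∂_θ𝒞₁'; computed here)] -/
theorem hasDerivAt_dCarter_etaphi (hs : Real.sin θ ≠ 0) :
    HasDerivAt (fun x => dCarter_dtheta a σ x θ) (-(4 * ηφ * Real.cos θ / Real.sin θ ^ 3)) ηφ := by
  unfold dCarter_dtheta
  refine ((hasDerivAt_const ηφ (2 * (Real.cos θ / Real.sin θ))).fun_mul ((hasDerivAt_const ηφ _).fun_sub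
    (((hasDerivAt_id' ηφ).fun_pow 2).div_const (Real.sin θ ^ 2)))).congr_deriv ?_
  field_simp
  ring

/-- **AUDIT DATUM (NIL): at `θ = π/2` the mixed partial VANISHES**, `∂_{η_ϕ}∂_θ𝒞|_{θ=π/2} = −4η_ϕ·cos(π/2)/sin³(π/2) = 0`, so the
linearised system on `E` is `∂_sv_{η_θ} = −∂_θ²𝒞₁v_θ` with NO `v_{η_ϕ}`-forcing; [AF] l.4938 prints "`+ 4η_ϕ(0)v_{η_ϕ}(0)`" (and
l.4942 "`+ 8η_ϕ(0)v_{η_ϕ}(0)`").  Either way the `(v_θ, v_{η_θ})`-block is a harmonic oscillator with at most constant forcing, so the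
conclusion (4.60) is unaffected. [cite: Hintz2026WavesII, TeX l.4936-4942 (value checked here: 0); Dyatlov2015, §3.2 proof of Prop. 3.6 Case 2 (held text p.17, keeps '−∂²_{θξ_φ}G v_{ξ_φ}' symbolic)] -/
theorem dCarter_etaphi_equator :
    -(4 * ηφ * Real.cos (Real.pi / 2) / Real.sin (Real.pi / 2) ^ 3) = 0 := by
  simp [Real.cos_pi_div_two]

/-- `∂_θ𝒞 = 0` at `θ = π/2` (cot = 0): the equator is critical for every `(η_ϕ, σ)`. [cite: Hintz2026WavesII, TeX l.4911, l.4932 ('θ(s) = π/2'; computed here)] -/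
theorem dCarter_dtheta_equator : dCarter_dtheta a σ ηφ (Real.pi / 2) = 0 := by
  simp [dCarter_dtheta, Real.cos_pi_div_two]

/-- **The degenerate locus off the equator**: "`∂_θ𝒞₁ = 2cot θ(a²sin²θ − η_ϕ²/sin²θ) = 0`, which for `θ ≠ π/2` implies
`η_ϕ²/sin²θ = a²sin²θ`" — with `σ`: `cos θ ≠ 0`, `sin θ ≠ 0` and `∂_θ𝒞 = 0` iff `η_ϕ² = a²σ²sin⁴θ`.
[cite: Hintz2026WavesII, TeX l.4911 (reproduced, σ kept)] -/
theorem dCarter_dtheta_eq_zero_iff (hs : Real.sin θ ≠ 0) (hc : Real.cos θ ≠ 0) :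
    dCarter_dtheta a σ ηφ θ = 0 ↔ ηφ ^ 2 = a ^ 2 * σ ^ 2 * (Real.sin θ ^ 2) ^ 2 := by
  unfold dCarter_dtheta
  have hs2 : Real.sin θ ^ 2 ≠ 0 := pow_ne_zero 2 hs
  constructor
  · intro h
    have h' : 2 * (Real.cos θ / Real.sin θ) ≠ 0 := by positivity
    have h2 := (mul_eq_zero.mp h).resolve_left h'
    field_simp at h2
    linear_combination -h2
  · intro h
    have : a ^ 2 * σ ^ 2 * Real.sin θ ^ 2 - ηφ ^ 2 / Real.sin θ ^ 2 = 0 := by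
      rw [h]; field_simp; ring
    rw [this, mul_zero]

/-- **On the degenerate locus `η_θ = 0`, `η_ϕ² = a²σ²sin⁴θ`: `𝒞 = −2aσB`** (`sin²θ ≠ 0`), so that (4.61) `0 = −μ⁻¹A² + 𝒞₁ = −μ⁻¹A² − 2aB`
reads, with `σ` kept, `A²/μ + 2aσB = 0`. [cite: Hintz2026WavesII, eq. (4.61) `EqTs3bONHyp0` TeX l.4912-4914 (reproduced, σ kept)] -/
theorem carterC_degenerate (hs : s2 ≠ 0) (hθ0 : ηθ = 0) (hdeg : ηφ ^ 2 = a ^ 2 * σ ^ 2 * s2 ^ 2) :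
    carterC a s2 σ ηθ ηφ = -(2 * a * σ * Bfn a s2 σ ηφ) := by
  subst hθ0
  unfold carterC Bfn
  field_simp
  linear_combination hdeg

/-- **The homogenisation identity of l.4917, verbatim (with `σ` kept):** for `A, μ, ϱ² ≠ 0` and `ϱ²σ = −A + aB` (l.4467),
`A²/μ + 2aσB = (A²/μ)(1 − 2aμB/(Aϱ²)) + 2a²B²/ϱ²`. [cite: Hintz2026WavesII, TeX l.4914-4918 (reproduced)] -/
theorem homogenize {A B ρ2 μ : ℝ} (hA : A ≠ 0) (hμ : μ ≠ 0) (hρ : ρ2 ≠ 0) (hσ : ρ2 * σ = -A + a * B) :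
    A ^ 2 / μ + 2 * a * σ * B = A ^ 2 / μ * (1 - 2 * a * μ * B / (A * ρ2)) + 2 * a ^ 2 * B ^ 2 / ρ2 := by
  have hσ' : σ = (-A + a * B) / ρ2 := by field_simp; linarith
  subst hσ'
  field_simp
  ring

/-- **`r⁴ − 4a²μ = (r² − 2a²)² + 8a²(𝔪r − a²)`** — the identity printed at l.4919. [cite: Hintz2026WavesII, TeX l.4919 (reproduced)] -/
theorem r4_sub : r ^ 4 - 4 * a ^ 2 * mu m a r = (r ^ 2 - 2 * a ^ 2) ^ 2 + 8 * a ^ 2 * (m * r - a ^ 2) := by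
  simp only [mu]; ring

/-- **`r⁴ > 4a²μ`** for `r > 𝔪 > 0` and `a² ≤ 𝔪²` — [AF]: "which holds in view of `|a| < 𝔪 < r`"; the kernel needs only
`a² ≤ 𝔪²` (EXTREMAL INCLUDED): `μ ≤ (r−𝔪)²`, `4𝔪²(r−𝔪)² < r⁴` since `r² − 2𝔪(r−𝔪) = (r−𝔪)² + 𝔪² > 0`.
[cite: Hintz2026WavesII, TeX l.4919 (reproduced; scope: a² ≤ 𝔪² suffices)] -/
theorem four_a2_mu_lt_r4 (hm : 0 < m) (hmr : m < r) (ha : a ^ 2 ≤ m ^ 2) : 4 * a ^ 2 * mu m a r < r ^ 4 := by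
  have hr : 0 < r := lt_trans hm hmr
  have hμle : mu m a r ≤ (r - m) ^ 2 := by simp only [mu]; nlinarith
  rcases le_or_gt (mu m a r) 0 with hμ | hμ
  · have : 4 * a ^ 2 * mu m a r ≤ 0 := mul_nonpos_of_nonneg_of_nonpos (by positivity) hμ
    have : 0 < r ^ 4 := by positivity
    linarith
  · have h1 : 4 * a ^ 2 * mu m a r ≤ 4 * m ^ 2 * (r - m) ^ 2 := by
      nlinarith [mul_le_mul_of_nonneg_left hμle (by positivity : (0:ℝ) ≤ 4 * a ^ 2),
        mul_le_mul_of_nonneg_right ha (sq_nonneg (r - m))]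
    have h2 : 2 * m * (r - m) < r ^ 2 := by nlinarith [sq_nonneg (r - m)]
    have h3 : 0 ≤ 2 * m * (r - m) := by nlinarith
    have h4 : (2 * m * (r - m)) ^ 2 < (r ^ 2) ^ 2 := by nlinarith
    nlinarith

/-- **The parenthesis is positive, `√`-free:** with `μB² ≤ A²` ((4.33)), `ϱ² ≥ r²` and `r⁴ > 4a²μ`, the cross term `X := 2aμB/(Aϱ²)` has
`X² = 4a²μ·(μB²)/(A²ϱ⁴) ≤ 4a²μ/ϱ⁴ < 1`, hence `1 − X > 0` ([AF]: "bounded from below by `1 − 2a√μ/ϱ²` … positive").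
[cite: Hintz2026WavesII, TeX l.4918-4919 (reproduced without square roots)] -/
theorem cross_term_sq_lt_one {A B ρ2 : ℝ} (hm : 0 < m) (hmr : m < r) (ha : a ^ 2 ≤ m ^ 2) (hμ : 0 < mu m a r) (hA : A ≠ 0)
    (hρr : r ^ 2 ≤ ρ2) (hB2 : mu m a r * B ^ 2 ≤ A ^ 2) :
    (2 * a * mu m a r * B / (A * ρ2)) ^ 2 < 1 := by
  have hr : 0 < r := lt_trans hm hmr
  have hρ : 0 < ρ2 := lt_of_lt_of_le (by positivity) hρr
  have h4 := four_a2_mu_lt_r4 a m r hm hmr ha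
  have hA2 : 0 < A ^ 2 := by positivity
  have hden : 0 < (A * ρ2) ^ 2 := by positivity
  rw [div_pow, div_lt_one hden]
  -- `(2aμB)² = 4a²μ·(μB²) ≤ 4a²μ·A² < r⁴A² ≤ ϱ⁴A² = (Aϱ²)²`
  have s1 : (2 * a * mu m a r * B) ^ 2 ≤ 4 * a ^ 2 * mu m a r * A ^ 2 := by
    have hid : (2 * a * mu m a r * B) ^ 2 = 4 * a ^ 2 * mu m a r * (mu m a r * B ^ 2) := by ring
    rw [hid]
    exact mul_le_mul_of_nonneg_left hB2 (by positivity)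
  have s2 : 4 * a ^ 2 * mu m a r * A ^ 2 < r ^ 4 * A ^ 2 := mul_lt_mul_of_pos_right h4 hA2
  have s3 : r ^ 4 * A ^ 2 ≤ (A * ρ2) ^ 2 := by
    have : r ^ 4 ≤ ρ2 ^ 2 := by nlinarith
    nlinarith
  linarith

/-- **CONCLUSION off the poles (the content of [AF] l.4910–4919): no point of `{ξ = 0} ∩ Σ ∖ o` with `0 < sin²θ ≤ 1` lies on the
degenerate locus `η_θ = 0 ∧ η_ϕ² = a²σ²sin⁴θ`** — for `r > 𝔪 > 0`, `a² ≤ 𝔪²` (extremal included), `μ > 0`; in particular on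
`Γ_{𝕊²} ⊂ Γ₀` the differentials `dη_ϕ`, `d𝒞₁` are linearly independent away from `θ = π/2` (and away from the poles, treated in §5).
Proof as printed: `𝒞 = −2aσB` and `𝒞 = A²/μ` give `A²/μ + 2aσB = 0`; homogenise; the parenthesis is `> 0` and `2a²B²/ϱ² ≥ 0`, so
`A = 0` — the zero section. [cite: Hintz2026WavesII, proof of Prop. 4.19(3) TeX l.4910-4919 with eq. (4.61) (reproduced); Dyatlov2015, §3.2 (held text p.16 (e:kdstr-4), by a different route)] -/
theorem nondegenerate_off_equator {m a r s2 σ ξ ηθ ηφ : ℝ} (hm : 0 < m) (hmr : m < r) (ha : a ^ 2 ≤ m ^ 2)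
    (hμ : 0 < mu m a r) (hs : 0 < s2) (hs1 : s2 ≤ 1) (hξ : ξ = 0) (hG : G3b m a r s2 σ ξ ηθ ηφ = 0)
    (hne : ¬(σ = 0 ∧ ξ = 0 ∧ ηθ = 0 ∧ ηφ = 0)) (hθ0 : ηθ = 0) (hdeg : ηφ ^ 2 = a ^ 2 * σ ^ 2 * s2 ^ 2) : False := by
  have hr : 0 < r := lt_trans hm hmr
  have hρ : 0 < rhoSq a r s2 := by
    simp only [rhoSq]; nlinarith [mul_nonneg (sq_nonneg a) (sub_nonneg.mpr hs1)]
  have hA := A_ne_zero hs hρ hξ hG hne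
  -- the two expressions for `𝒞`
  have hC1 := carterC_eq_of_onSigma hξ hG
  have hC2 := carterC_degenerate a s2 σ ηθ ηφ hs.ne' hθ0 hdeg
  have h61 : Afn a r σ ηφ ^ 2 / mu m a r + 2 * a * σ * Bfn a s2 σ ηφ = 0 := by linarith
  -- `μB² ≤ A²` (module 76 `mu_Bsq_le_Asq`)
  have hB2 := mu_Bsq_le_Asq hμ hs hs1 hξ hG
  -- homogenise
  have hσ : rhoSq a r s2 * σ = -Afn a r σ ηφ + a * Bfn a s2 σ ηφ := rhoSq_mul_sigma a r s2 σ ηφ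
  rw [homogenize a σ hA hμ.ne' hρ.ne' hσ] at h61
  have hρr : r ^ 2 ≤ rhoSq a r s2 := by
    simp only [rhoSq]; nlinarith [mul_nonneg (sq_nonneg a) (sub_nonneg.mpr hs1)]
  have hX := cross_term_sq_lt_one a m r hm hmr ha hμ hA hρr hB2
  have hX' : 0 < 1 - 2 * a * mu m a r * Bfn a s2 σ ηφ / (Afn a r σ ηφ * rhoSq a r s2) := by
    have hX1 : (2 * a * mu m a r * Bfn a s2 σ ηφ / (Afn a r σ ηφ * rhoSq a r s2)) ^ 2 < 1 ^ 2 := by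
      rwa [one_pow]
    have := (abs_lt_of_sq_lt_sq' hX1 zero_le_one)
    linarith [this.2]
  have hpos : 0 < Afn a r σ ηφ ^ 2 / mu m a r * (1 - 2 * a * mu m a r * Bfn a s2 σ ηφ / (Afn a r σ ηφ * rhoSq a r s2)) := by
    have : 0 < Afn a r σ ηφ ^ 2 / mu m a r := by positivity
    exact mul_pos this hX'
  have hnn : 0 ≤ 2 * a ^ 2 * Bfn a s2 σ ηφ ^ 2 / rhoSq a r s2 := by positivity
  linarith

end OffPoles

/-! ## 5. [AF] Prop. 4.19(3) AT THE POLES: `dη_ϕ = η₂dω¹ − η₁dω²`, `d𝒞 = 2η·dη − 2aσ dη_ϕ`, independence, involution -/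

section Poles

variable (a σ ω₁ ω₂ η₁ η₂ : ℝ)

/-- `∂_{ω¹}η_ϕ = η₂`. [cite: Hintz2026WavesII, TeX l.4920 ('dη_ϕ = η₂dω¹ − η₁dω²'; reproduced)] -/
theorem hasDerivAt_Lpol_omega1 : HasDerivAt (fun x => Lpol x ω₂ η₁ η₂) η₂ ω₁ := by
  unfold Lpol
  simpa using ((hasDerivAt_id' ω₁).mul_const η₂).sub_const (ω₂ * η₁)

/-- `∂_{ω²}η_ϕ = −η₁`. [cite: Hintz2026WavesII, TeX l.4920 (reproduced)] -/
theorem hasDerivAt_Lpol_omega2 : HasDerivAt (fun x => Lpol ω₁ x η₁ η₂) (-η₁) ω₂ := by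
  unfold Lpol
  simpa using ((hasDerivAt_id' ω₂).mul_const η₁).const_sub (ω₁ * η₂)

/-- `∂_{η₁}η_ϕ = −ω²` (vanishes at the pole). [cite: Hintz2026WavesII, TeX l.4920 (computed here)] -/
theorem hasDerivAt_Lpol_eta1 : HasDerivAt (fun x => Lpol ω₁ ω₂ x η₂) (-ω₂) η₁ := by
  unfold Lpol
  simpa using ((hasDerivAt_id' η₁).const_mul ω₂).const_sub (ω₁ * η₂)

/-- `∂_{η₂}η_ϕ = ω¹` (vanishes at the pole). [cite: Hintz2026WavesII, TeX l.4920 (computed here)] -/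
theorem hasDerivAt_Lpol_eta2 : HasDerivAt (fun x => Lpol ω₁ ω₂ η₁ x) ω₁ η₂ := by
  unfold Lpol
  simpa using ((hasDerivAt_id' η₂).const_mul ω₁).sub_const (ω₂ * η₁)

/-- `∂_{ω¹}𝒞 = −2aσ(η₂ − aσω¹) − 2(ω·η)η₁` (general `ω`). [cite: Hintz2026WavesII, eq. (4.22) TeX l.4361 (computed here)] -/
theorem hasDerivAt_carterCpol_omega1 :
    HasDerivAt (fun x => carterCpol a x ω₂ σ η₁ η₂)
      (-(2 * a * σ * (η₂ - a * σ * ω₁)) - 2 * (ω₁ * η₁ + ω₂ * η₂) * η₁) ω₁ := by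
  unfold carterCpol
  have h2 : HasDerivAt (fun x => η₂ - a * σ * x) (-(a * σ)) ω₁ := by
    simpa using ((hasDerivAt_id' ω₁).const_mul (a * σ)).const_sub η₂
  have h3 : HasDerivAt (fun x => x * η₁ + ω₂ * η₂) η₁ ω₁ := by
    simpa using ((hasDerivAt_id' ω₁).mul_const η₁).add_const (ω₂ * η₂)
  exact (((hasDerivAt_const ω₁ _).fun_add (h2.fun_pow 2)).fun_sub (h3.fun_pow 2)).congr_deriv (by ring)

/-- `∂_{ω²}𝒞 = 2aσ(η₁ + aσω²) − 2(ω·η)η₂` (general `ω`). [cite: Hintz2026WavesII, eq. (4.22) TeX l.4361 (computed here)] -/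
theorem hasDerivAt_carterCpol_omega2 :
    HasDerivAt (fun x => carterCpol a ω₁ x σ η₁ η₂)
      (2 * a * σ * (η₁ + a * σ * ω₂) - 2 * (ω₁ * η₁ + ω₂ * η₂) * η₂) ω₂ := by
  unfold carterCpol
  have h1 : HasDerivAt (fun x => η₁ + a * σ * x) (a * σ) ω₂ := by
    simpa using ((hasDerivAt_id' ω₂).const_mul (a * σ)).const_add η₁
  have h3 : HasDerivAt (fun x => ω₁ * η₁ + x * η₂) η₂ ω₂ := by
    simpa using ((hasDerivAt_id' ω₂).mul_const η₂).const_add (ω₁ * η₁)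
  exact (((h1.fun_pow 2).fun_add (hasDerivAt_const ω₂ _)).fun_sub (h3.fun_pow 2)).congr_deriv (by ring)

/-- `∂_{η₁}𝒞 = 2(η₁ + aσω²) − 2(ω·η)ω¹` (general `ω`). [cite: Hintz2026WavesII, eq. (4.22) TeX l.4361 (computed here)] -/
theorem hasDerivAt_carterCpol_eta1 :
    HasDerivAt (fun x => carterCpol a ω₁ ω₂ σ x η₂)
      (2 * (η₁ + a * σ * ω₂) - 2 * (ω₁ * η₁ + ω₂ * η₂) * ω₁) η₁ := by
  unfold carterCpol
  have h1 : HasDerivAt (fun x => x + a * σ * ω₂) 1 η₁ := (hasDerivAt_id' η₁).add_const _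
  have h3 : HasDerivAt (fun x => ω₁ * x + ω₂ * η₂) ω₁ η₁ := by
    simpa using ((hasDerivAt_id' η₁).const_mul ω₁).add_const (ω₂ * η₂)
  exact (((h1.fun_pow 2).fun_add (hasDerivAt_const η₁ _)).fun_sub (h3.fun_pow 2)).congr_deriv (by ring)

/-- `∂_{η₂}𝒞 = 2(η₂ − aσω¹) − 2(ω·η)ω²` (general `ω`). [cite: Hintz2026WavesII, eq. (4.22) TeX l.4361 (computed here)] -/
theorem hasDerivAt_carterCpol_eta2 :
    HasDerivAt (fun x => carterCpol a ω₁ ω₂ σ η₁ x)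
      (2 * (η₂ - a * σ * ω₁) - 2 * (ω₁ * η₁ + ω₂ * η₂) * ω₂) η₂ := by
  unfold carterCpol
  have h2 : HasDerivAt (fun x => x - a * σ * ω₁) 1 η₂ := (hasDerivAt_id' η₂).sub_const _
  have h3 : HasDerivAt (fun x => ω₁ * η₁ + ω₂ * x) ω₂ η₂ := by
    simpa using ((hasDerivAt_id' η₂).const_mul ω₂).const_add (ω₁ * η₁)
  exact (((hasDerivAt_const η₂ _).fun_add (h2.fun_pow 2)).fun_sub (h3.fun_pow 2)).congr_deriv (by ring)

/-- **AT THE POLE `ω = 0` the two gradients are exactly as printed**: `dη_ϕ = η₂dω¹ − η₁dω²` (components `(η₂, −η₁, 0, 0)` in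
`(dω¹, dω², dη₁, dη₂)`) and `d𝒞 = 2η·dη − 2aσ dη_ϕ` (components `(−2aση₂, 2aση₁, 2η₁, 2η₂)`; [AF] at `σ = 1`).
[cite: Hintz2026WavesII, TeX l.4919-4921 (reproduced)] -/
theorem pole_gradients :
    HasDerivAt (fun x => Lpol x 0 η₁ η₂) η₂ 0 ∧ HasDerivAt (fun x => Lpol 0 x η₁ η₂) (-η₁) 0 ∧
    HasDerivAt (fun x => Lpol 0 0 x η₂) 0 η₁ ∧ HasDerivAt (fun x => Lpol 0 0 η₁ x) 0 η₂ ∧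
    HasDerivAt (fun x => carterCpol a x 0 σ η₁ η₂) (-(2 * a * σ * η₂)) 0 ∧
    HasDerivAt (fun x => carterCpol a 0 x σ η₁ η₂) (2 * a * σ * η₁) 0 ∧
    HasDerivAt (fun x => carterCpol a 0 0 σ x η₂) (2 * η₁) η₁ ∧
    HasDerivAt (fun x => carterCpol a 0 0 σ η₁ x) (2 * η₂) η₂ := by
  refine ⟨hasDerivAt_Lpol_omega1 0 0 η₁ η₂, hasDerivAt_Lpol_omega2 0 0 η₁ η₂, ?_, ?_, ?_, ?_, ?_, ?_⟩
  · simpa using hasDerivAt_Lpol_eta1 0 0 η₁ η₂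
  · simpa using hasDerivAt_Lpol_eta2 0 0 η₁ η₂
  · exact (hasDerivAt_carterCpol_omega1 a σ 0 0 η₁ η₂).congr_deriv (by ring)
  · exact (hasDerivAt_carterCpol_omega2 a σ 0 0 η₁ η₂).congr_deriv (by ring)
  · exact (hasDerivAt_carterCpol_eta1 a σ 0 0 η₁ η₂).congr_deriv (by ring)
  · exact (hasDerivAt_carterCpol_eta2 a σ 0 0 η₁ η₂).congr_deriv (by ring)

/-- The two gradient rows at the pole, as vectors in `(dω¹, dω², dη₁, dη₂)`. [cite: Hintz2026WavesII, TeX l.4919-4921 (transcription)] -/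
def dLpole (η₁ η₂ : ℝ) : Fin 4 → ℝ := ![η₂, -η₁, 0, 0]

/-- See `dLpole`. [cite: Hintz2026WavesII, TeX l.4919-4921 (transcription)] -/
def dCpole (a σ η₁ η₂ : ℝ) : Fin 4 → ℝ := ![-(2 * a * σ * η₂), 2 * a * σ * η₁, 2 * η₁, 2 * η₂]

/-- **"which are linearly independent since `η = (η₁, η₂) ≠ 0`"**: at the pole, `c₁dη_ϕ + c₂d𝒞 = 0` forces `c₁ = c₂ = 0` whenever
`η ≠ 0` (any real `a, σ`). [cite: Hintz2026WavesII, TeX l.4919-4921 (reproduced)] -/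
theorem pole_rows_independent (hη : ¬(η₁ = 0 ∧ η₂ = 0)) (c₁ c₂ : ℝ)
    (h : c₁ • dLpole η₁ η₂ + c₂ • dCpole a σ η₁ η₂ = 0) : c₁ = 0 ∧ c₂ = 0 := by
  have h0 := congr_fun h 0
  have h1 := congr_fun h 1
  have h2 := congr_fun h 2
  have h3 := congr_fun h 3
  simp [dLpole, dCpole] at h0 h1 h2 h3
  have hc2 : c₂ = 0 := by
    by_contra hc
    apply hη
    rcases h2 with h | h
    · exact absurd h hc
    · rcases h3 with h' | h'
      · exact absurd h' hc
      · exact ⟨h, h'⟩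
  subst hc2
  simp at h0 h1
  refine ⟨?_, rfl⟩
  by_contra hc
  apply hη
  rcases h1 with h | h
  · exact absurd h hc
  · rcases h0 with h' | h'
    · exact absurd h' hc
    · exact ⟨h, h'⟩

/-- Conversely at `η = 0` both rows vanish (so `η ≠ 0` is exactly the condition). [cite: Hintz2026WavesII, TeX l.4921 (computed here)] -/
theorem pole_rows_zero_of_eta_zero : dLpole 0 0 = 0 ∧ dCpole a σ 0 0 = 0 := by
  constructor <;> (ext i; fin_cases i <;> simp [dLpole, dCpole])

/-- **"`𝒞₁` and `η_ϕ` are … in involution"** — the Poisson bracket `{η_ϕ, 𝒞} = Σ_i (∂_{ω^i}η_ϕ·∂_{η_i}𝒞 − ∂_{η_i}η_ϕ·∂_{ω^i}𝒞)` in the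
canonical polar coordinates `(ω; η)`, assembled from the certified partials above, VANISHES IDENTICALLY (all `ω`, all real `a, σ`) —
the rotation invariance of (4.22); in the BL chart this is the trivial `∂_ϕ𝒞 = 0`. [cite: Hintz2026WavesII, TeX l.4910-4911 (reproduced in the polar chart); Dyatlov2015, §3.1 (held text p.14 '{G_r, G_θ} = 0 and G_θ, τ, ξ_φ are conserved')] -/
theorem poisson_Lpol_carterCpol :
    η₂ * (2 * (η₁ + a * σ * ω₂) - 2 * (ω₁ * η₁ + ω₂ * η₂) * ω₁)
      + (-η₁) * (2 * (η₂ - a * σ * ω₁) - 2 * (ω₁ * η₁ + ω₂ * η₂) * ω₂)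
      - (-ω₂) * (-(2 * a * σ * (η₂ - a * σ * ω₁)) - 2 * (ω₁ * η₁ + ω₂ * η₂) * η₁)
      - ω₁ * (2 * a * σ * (η₁ + a * σ * ω₂) - 2 * (ω₁ * η₁ + ω₂ * η₂) * η₂) = 0 := by
  ring

end Poles

/-! ## 6. [AF] Prop. 4.19(3) on the equatorial set `E`: the orbit (4.62), `∂_θ²𝒞 = 2(η_ϕ² − a²σ²) > 2𝔪²σ²` -/

section Equator

variable (a m r σ ξ ηφ : ℝ)

/-- **(4.62) integrated**: the curve `θ(s) = π/2`, `ϕ(s) = ϕ₀ + 2s(η_ϕ(0) − aσ)`, `η_θ(s) = 0`, `η_ϕ(s) = η_ϕ(0)` solves Hamilton's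
equations `∂_sθ = ∂_{η_θ}𝒞 = 2η_θ`, `∂_sϕ = ∂_{η_ϕ}𝒞 = 2(η_ϕ/sin²θ − aσ)`, `∂_sη_θ = −∂_θ𝒞`, `∂_sη_ϕ = −∂_ϕ𝒞 = 0` of `𝒞` on `T*𝕊²`: the
four `s`-derivatives are `(0, 2(η_ϕ(0) − aσ), 0, 0)` and these ARE the four right-hand sides on the curve (`sin(π/2) = 1`,
`∂_θ𝒞|_{θ=π/2} = 0`, `2·0 = 0`). [cite: Hintz2026WavesII, eq. (4.62) `EqTs3bONHypFlow` and TeX l.4932 (reproduced, σ kept)] -/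
theorem equatorial_orbit (φ0 ηφ0 s : ℝ) :
    HasDerivAt (fun _ : ℝ => Real.pi / 2) (2 * (0 : ℝ)) s ∧
    HasDerivAt (fun t : ℝ => φ0 + 2 * t * (ηφ0 - a * σ)) (2 * (ηφ0 / Real.sin (Real.pi / 2) ^ 2 - a * σ)) s ∧
    HasDerivAt (fun _ : ℝ => (0 : ℝ)) (-dCarter_dtheta a σ ηφ0 (Real.pi / 2)) s ∧
    HasDerivAt (fun _ : ℝ => ηφ0) 0 s := by
  refine ⟨by simpa using hasDerivAt_const s (Real.pi / 2), ?_, ?_, hasDerivAt_const s ηφ0⟩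
  · have h : HasDerivAt (fun t : ℝ => φ0 + 2 * t * (ηφ0 - a * σ)) (2 * (ηφ0 - a * σ)) s := by
      simpa using (((hasDerivAt_id' s).const_mul 2).mul_const (ηφ0 - a * σ)).const_add φ0
    simpa [Real.sin_pi_div_two] using h
  · rw [dCarter_dtheta_equator, neg_zero]
    exact hasDerivAt_const s 0

/-- **The linearisation on `E` in the `(v_θ, v_{η_θ})`-block**: `∂_sv_θ = 2v_{η_θ}` (from `∂_{η_θ}(2η_θ) = 2`) and
`∂_sv_{η_θ} = −∂_θ²𝒞|_E·v_θ − ∂_{η_ϕ}∂_θ𝒞|_E·v_{η_ϕ} = −2(η_ϕ² − a²σ²)v_θ − 0`, hence `∂_s²v_θ = −4(η_ϕ² − a²σ²)v_θ` — the printed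
"`∂_s²v_θ = −2∂_θ²𝒞₁v_θ`" WITHOUT the printed forcing term (see `dCarter_etaphi_equator`).  Stated as the values of the two
coefficients. [cite: Hintz2026WavesII, TeX l.4935-4944 (reproduced; forcing term corrected to 0)] -/
theorem equator_linearisation_coefficients :
    d2Carter a σ ηφ (Real.pi / 2) = 2 * (ηφ ^ 2 - a ^ 2 * σ ^ 2) ∧
      -(4 * ηφ * Real.cos (Real.pi / 2) / Real.sin (Real.pi / 2) ^ 3) = 0 :=
  ⟨d2Carter_equator a σ ηφ, dCarter_etaphi_equator ηφ⟩

/-- **The identity behind l.4944–4948** (at `sin²θ = 1`, `σ` kept): `(r²+a²)B² − A² = r²(η_ϕ² − (r²+a²)σ²)` with `A = −(r²+a²)σ + aη_ϕ`,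
`B = η_ϕ − aσ` — so "`A² < (r²+a²)B²` … is equivalent to `η_ϕ² > r² + a²`" (at `σ = 1`).
[cite: Hintz2026WavesII, TeX l.4944-4948 (reproduced)] -/
theorem equator_identity :
    (r ^ 2 + a ^ 2) * Bfn a 1 σ ηφ ^ 2 - Afn a r σ ηφ ^ 2 = r ^ 2 * (ηφ ^ 2 - (r ^ 2 + a ^ 2) * σ ^ 2) := by
  simp only [Bfn, Afn]; ring

/-- "`A² = μB²` at `E`" ((4.33) with `η_θ = 0`, `sin²θ = 1`), on `Σ ∩ {ξ = 0}`. [cite: Hintz2026WavesII, TeX l.4944 ('recall from (4.33) that A² = μB² ≠ 0 at E'; reproduced)] -/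
theorem Asq_eq_mu_Bsq_at_E {m a r σ ξ ηφ : ℝ} (hμ : mu m a r ≠ 0) (hξ : ξ = 0) (hG : G3b m a r 1 σ ξ 0 ηφ = 0) :
    Afn a r σ ηφ ^ 2 = mu m a r * Bfn a 1 σ ηφ ^ 2 := by
  have hC := carterC_eq_of_onSigma hξ hG
  have hC1 : carterC a 1 σ 0 ηφ = Bfn a 1 σ ηφ ^ 2 := by simp [carterC, Bfn]
  rw [hC1] at hC
  rw [hC]
  field_simp

/-- **`η_ϕ² > (r²+a²)σ²` on `E ∖ o`** (`r > 0`, `𝔪 > 0`, `μ > 0`, every real `a`; [AF] at `σ = 1`: "`η_ϕ² > r²+a² > 𝔪²+a²`"; Dyatlov: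
"`ξ_φ²/sin²θ > (r²+a²)τ²`"): from `A² = μB² ≠ 0` and `μ < r²+a²`. [cite: Hintz2026WavesII, TeX l.4944-4948 (reproduced); Dyatlov2015, §3.2 (held text p.16 display (e:xi-phi-bound))] -/
theorem etaphi_sq_gt {m a r σ ξ ηφ : ℝ} (hm : 0 < m) (hr : 0 < r) (hμ : 0 < mu m a r) (hξ : ξ = 0)
    (hG : G3b m a r 1 σ ξ 0 ηφ = 0) (hne : ¬(σ = 0 ∧ ξ = 0 ∧ (0 : ℝ) = 0 ∧ ηφ = 0)) :
    (r ^ 2 + a ^ 2) * σ ^ 2 < ηφ ^ 2 := by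
  have hρ : 0 < rhoSq a r 1 := by simp only [rhoSq]; nlinarith
  have hA := A_ne_zero one_pos hρ hξ hG hne
  have hAB := Asq_eq_mu_Bsq_at_E hμ.ne' hξ hG
  have hA2 : 0 < Afn a r σ ηφ ^ 2 := by positivity
  have hB2 : 0 < Bfn a 1 σ ηφ ^ 2 := by
    by_contra hc
    have : Bfn a 1 σ ηφ ^ 2 = 0 := le_antisymm (not_lt.mp hc) (sq_nonneg _)
    rw [this, mul_zero] at hAB
    linarith
  have hμlt : mu m a r < r ^ 2 + a ^ 2 := by simp only [mu]; nlinarith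
  have hlt : Afn a r σ ηφ ^ 2 < (r ^ 2 + a ^ 2) * Bfn a 1 σ ηφ ^ 2 := by
    rw [hAB]; exact mul_lt_mul_of_pos_right hμlt hB2
  have hid := equator_identity a r σ ηφ
  have : 0 < r ^ 2 * (ηφ ^ 2 - (r ^ 2 + a ^ 2) * σ ^ 2) := by linarith
  have hr2 : 0 < r ^ 2 := by positivity
  nlinarith

/-- **`∂_θ²𝒞|_E = 2(η_ϕ² − a²σ²) > 2r²σ² ≥ 2𝔪²σ²`** on `E ∖ o` for `r > 𝔪 > 0`, `μ > 0`, every real `a` — [AF]'s "Thus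
`∂_θ²𝒞₁ > 2𝔪² > 0` indeed" (at `σ = 1`), the positivity that makes the `(v_θ, v_{η_θ})`-block an oscillator.
[cite: Hintz2026WavesII, TeX l.4944-4948 (reproduced); Dyatlov2015, §3.2 (held text p.16 (e:kdstr-5) '∂_θ²G = 2(ξ_φ² − a²τ²) > 0 on K̃_e')] -/
theorem d2Carter_equator_gt {m a r σ ξ ηφ : ℝ} (hm : 0 < m) (hmr : m < r) (hμ : 0 < mu m a r) (hξ : ξ = 0)
    (hG : G3b m a r 1 σ ξ 0 ηφ = 0) (hne : ¬(σ = 0 ∧ ξ = 0 ∧ (0 : ℝ) = 0 ∧ ηφ = 0)) :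
    2 * r ^ 2 * σ ^ 2 < d2Carter a σ ηφ (Real.pi / 2) ∧ 2 * m ^ 2 * σ ^ 2 ≤ 2 * r ^ 2 * σ ^ 2 := by
  have hr : 0 < r := lt_trans hm hmr
  have h := etaphi_sq_gt hm hr hμ hξ hG hne
  rw [d2Carter_equator]
  refine ⟨by nlinarith, ?_⟩
  have : m ^ 2 ≤ r ^ 2 := by nlinarith
  nlinarith [sq_nonneg σ]

end Equator

/-! ## 7. (4.50) made QUANTITATIVE: `H_{G_3b}𝔱` on `Γ₀` in closed form, `ν² > 16(𝔪+s)s`, `ν̃²` in closed form and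
`ν̃ > (2/115)·√(𝔪²−a²)/𝔪²` on `Γ₀ ∖ o` — an explicit `ν_min` for every subextremal `(𝔪, a)` -/

section Quantitative

variable {m a r s u σ ξ L ηθ : ℝ}

/-- **`ϱ²g⁻¹(d𝔱, ζ)` on `Γ₀` in closed form**: from the trapped relation (4.35) `A(r−𝔪) = −2rμσ` and `aB = A + ϱ²σ` (l.4467),
`ϱ²g⁻¹(d𝔱, ζ) = −(r²+a²)A/μ + aB = −2𝔪rA/μ + ϱ²σ = σ·(4𝔪r²/(r−𝔪) + ϱ²)` (`u` = the value of `sin²θ = |ω|²`, `L = η_ϕ`; `μ ≠ 0`,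
`r ≠ 𝔪`) — so `H_{G_3b}𝔱 = 2σ(4𝔪r²/(r−𝔪) + ϱ²)` is manifestly of the sign of `σ` (a second, one-line route to (4.41)–(4.42) on `Γ₀`;
Schwarzschild: `27𝔪²σ`). [cite: Hintz2026WavesII, eq. (4.41) `EqTs3bOTrapSign` TeX l.4596 with (4.35) l.4547 and l.4467 (closed form computed here); Hintz2026WavesII, TeX l.4758 ('H_{G_3b}𝔱 … is positive')] -/
theorem dtPairing_on_Gamma0 (hμ : mu m a r ≠ 0) (hrm : r ≠ m)
    (h1 : Afn a r σ L * (r - m) = -(2 * r * mu m a r * σ)) :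
    dtPairing m a r u σ L = σ * (4 * m * r ^ 2 / (r - m) + rhoSq a r u) := by
  have hrm' : r - m ≠ 0 := sub_ne_zero.mpr hrm
  have e := a_mul_B a r u σ L
  have hA : Afn a r σ L = -(2 * r * mu m a r * σ) / (r - m) := by
    field_simp
    linear_combination h1
  unfold dtPairing
  rw [e, hA]
  field_simp
  simp only [mu, rhoSq]
  ring

/-- Hence `H_{G_3b}𝔱 = 2σ(4𝔪r²/(r−𝔪) + ϱ²)` on `Γ₀`. [cite: Hintz2026WavesII, TeX l.4758 (closed form on Γ₀ computed here)] -/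
theorem HGt_on_Gamma0 (hμ : mu m a r ≠ 0) (hrm : r ≠ m)
    (h1 : Afn a r σ L * (r - m) = -(2 * r * mu m a r * σ)) :
    HGt m a r u σ L = 2 * σ * (4 * m * r ^ 2 / (r - m) + rhoSq a r u) := by
  unfold HGt
  rw [dtPairing_on_Gamma0 hμ hrm h1]
  ring

/-- The bracket `4𝔪r²/(r−𝔪) + ϱ²` is positive for `r > 𝔪 > 0`, `0 ≤ u ≤ 1` … indeed for any `u ≤ 1` (`ϱ² = r² + a²(1−u) ≥ r² > 0`):
explicitly `4𝔪r²/(r−𝔪) + ϱ² > r²`. [cite: Hintz2026WavesII, TeX l.4758 (positivity; computed here)] -/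
theorem HGt_bracket_gt (hm : 0 < m) (hmr : m < r) (hu : u ≤ 1) :
    r ^ 2 < 4 * m * r ^ 2 / (r - m) + rhoSq a r u := by
  have hr : 0 < r := lt_trans hm hmr
  have h1 : 0 < 4 * m * r ^ 2 / (r - m) := div_pos (by positivity) (sub_pos.mpr hmr)
  have h2 : r ^ 2 ≤ rhoSq a r u := by
    simp only [rhoSq]; nlinarith [mul_nonneg (sq_nonneg a) (sub_nonneg.mpr hu)]
  linarith

/-- **(4.41)–(4.42) on `Γ₀`, second route**: `σ·ϱ²g⁻¹(d𝔱,ζ) = σ²(4𝔪r²/(r−𝔪) + ϱ²) > 0` whenever `σ ≠ 0` (`r > 𝔪 > 0`, `u ≤ 1`, `μ ≠ 0`).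
[cite: Hintz2026WavesII, eqs. (4.41)-(4.42) TeX l.4593-4603 (reproduced by the closed form)] -/
theorem sigma_mul_dtPairing_pos_of_trapped (hm : 0 < m) (hmr : m < r) (hu : u ≤ 1) (hμ : mu m a r ≠ 0) (hσ : σ ≠ 0)
    (h1 : Afn a r σ L * (r - m) = -(2 * r * mu m a r * σ)) : 0 < σ * dtPairing m a r u σ L := by
  rw [dtPairing_on_Gamma0 hμ (ne_of_gt hmr) h1]
  have hb := HGt_bracket_gt (a := a) hm hmr hu
  have hr2 : 0 < r ^ 2 := pow_pos (lt_trans hm hmr) 2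
  have hσ2 : 0 < σ ^ 2 := by positivity
  have : σ * (σ * (4 * m * r ^ 2 / (r - m) + rhoSq a r u)) = σ ^ 2 * (4 * m * r ^ 2 / (r - m) + rhoSq a r u) := by ring
  rw [this]
  exact mul_pos hσ2 (lt_trans hr2 hb)

/-- The trapped relation in the form `A(r−𝔪) = −2rμσ` from `Ψ = 0`, `A ≠ 0` (chart-free; module 76 `trapped_relation` halved).
[cite: Hintz2026WavesII, eq. (4.35) `EqTs3bOConvSigma` TeX l.4545-4548 (reproduced)] -/
theorem trapped_relation_halved (hΨ : Psi m a r σ L = 0) (hA : Afn a r σ L ≠ 0) :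
    Afn a r σ L * (r - m) = -(2 * r * mu m a r * σ) := by
  have h := trapped_relation hΨ hA
  simp only [dmu] at h
  linear_combination (1 / 2 : ℝ) * h

/-- **`ν² > 16(𝔪 + s)s = 16 r₊√(𝔪²−a²)` on `Γ₀ ∖ o`** for `a² = 𝔪² − s²`, `s > 0`, `r > r₊ = 𝔪 + s`: from the closed form
`ν² = 16r(r−𝔪) + 16r𝔪s²/(r−𝔪)² ≥ 16r(r−𝔪)`.  An EXPLICIT lower bound for (4.50)'s `ν_min²` (in the `σ⁻¹H_{G_3b}` parametrisation),
degenerating like `s` at extremality. [cite: Hintz2026WavesII, Lemma 4.18 eq. (4.50) `EqTs3bOnuMin` TeX l.4712-4716 (explicit bound computed here); Dyatlov2015, §3.2 Prop. 3.7 ('ν̃ > 0')] -/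
theorem nuSq_gt (hs : 0 < s) (has : s ^ 2 + a ^ 2 = m ^ 2) (hm : 0 < m) (hr : m + s < r) (hσ : σ ≠ 0)
    (hΨ : Psi m a r σ L = 0) (hA : Afn a r σ L ≠ 0) : 16 * (m + s) * s < nuSq m a r σ L := by
  have hmr : m < r := by linarith
  have hr0 : 0 < r := by linarith
  have hμ : 0 < mu m a r := by
    rw [mu_eq_sq_sub (r := r) has]; nlinarith [mul_pos (by linarith : 0 < r - m - s) (by linarith : 0 < r - m + s)]
  rw [nuSq_closed_form m a r σ L hr0.ne' (ne_of_gt hmr) hμ.ne' hσ hΨ hA]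
  have hrm : 0 < r - m := by linarith
  have hrm2 : 0 < (r - m) ^ 2 := by positivity
  rw [lt_div_iff₀ hrm2]
  have e : m ^ 2 - a ^ 2 = s ^ 2 := by linarith
  rw [e]
  -- `16(m+s)s(r−m)² < 16r((r−m)³ + m s²)`: `(m+s)s < r(r−m)` and `0 ≤ 16 r m s²`
  have h1 : (m + s) * s < r * (r - m) := by nlinarith
  have h2 : 0 ≤ 16 * r * (m * s ^ 2) := by positivity
  nlinarith [mul_lt_mul_of_pos_right h1 hrm2]

/-- **`ν̃²` on `Γ₀ ∖ o` in closed form**: `ν̃² = σ²ν²/(H_{G_3b}𝔱)² = 4r((r−𝔪)³ + 𝔪(𝔪²−a²))/(4𝔪r² + ϱ²(r−𝔪))²` (`σ` cancels; the only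
angular dependence is through `ϱ² = r² + a²cos²θ`). Schwarzschild: `4·3𝔪·9𝔪³/(54𝔪³)² = 1/(27𝔪²)`.
[cite: Hintz2026WavesII, Lemma 4.18 with TeX l.4758, l.4863 (closed form computed here); Dyatlov2015, §3.2 Prop. 3.7 (held text (e:tilde-nu))] -/
theorem nuNormSq_on_Gamma0 (hr : r ≠ 0) (hrm : r ≠ m) (hμ : mu m a r ≠ 0) (hσ : σ ≠ 0) (hΨ : Psi m a r σ L = 0)
    (hA : Afn a r σ L ≠ 0) :
    nuNormSq m a r u σ L
      = 4 * r * ((r - m) ^ 3 + m * (m ^ 2 - a ^ 2)) / (4 * m * r ^ 2 + rhoSq a r u * (r - m)) ^ 2 := by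
  have h1 := trapped_relation_halved hΨ hA
  unfold nuNormSq
  rw [nuSq_closed_form m a r σ L hr hrm hμ hσ hΨ hA, HGt_on_Gamma0 hμ hrm h1]
  have hrm' : r - m ≠ 0 := sub_ne_zero.mpr hrm
  have hb : 4 * m * r ^ 2 / (r - m) + rhoSq a r u = (4 * m * r ^ 2 + rhoSq a r u * (r - m)) / (r - m) := by
    field_simp
  rw [hb]
  field_simp
  ring

/-- **An explicit `ν_min`: `ν̃² > 4(𝔪² − a²)/(115²𝔪⁴)`, i.e. `ν̃ > (2/115)·√(𝔪²−a²)/𝔪²`, on `Γ₀ ∖ o`** — for `a² = 𝔪² − s²`,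
`s > 0`, a point with `Ψ = 0`, `A ≠ 0`, `σ ≠ 0`, `r₊ < r < 4𝔪` (module 76 / §2: `r < 4𝔪` on `Γ₀ ∖ o`) and `0 ≤ u ≤ 1`
(`u = sin²θ = |ω|²`): numerator `4r((r−𝔪)³ + 𝔪s²) > 4𝔪²s²`, denominator `4𝔪r² + ϱ²(r−𝔪) < 64𝔪³ + 17𝔪²·3𝔪 = 115𝔪³`.  (Crude but
uniform; the true near-extremal rate at the prograde orbit is `≈ s/(2𝔪²)`, engine B.)  This is (4.50) with a NUMBER, for every
subextremal `(𝔪, a)`. [cite: Hintz2026WavesII, Lemma 4.18 eq. (4.50) `EqTs3bOnuMin` TeX l.4712-4716 (explicit lower bound computed here); Dyatlov2015, §3.2 Prop. 3.7, §3.3 Prop. 3.9] -/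
theorem nuNormSq_lower_bound (hs : 0 < s) (has : s ^ 2 + a ^ 2 = m ^ 2) (hm : 0 < m) (hr1 : m + s < r) (hr4 : r < 4 * m)
    (hu0 : 0 ≤ u) (hu1 : u ≤ 1) (hσ : σ ≠ 0) (hΨ : Psi m a r σ L = 0) (hA : Afn a r σ L ≠ 0) :
    4 * s ^ 2 / (115 ^ 2 * m ^ 4) < nuNormSq m a r u σ L := by
  have hmr : m < r := by linarith
  have hr0 : 0 < r := by linarith
  have hμ : 0 < mu m a r := by
    rw [mu_eq_sq_sub (r := r) has]; nlinarith [mul_pos (by linarith : 0 < r - m - s) (by linarith : 0 < r - m + s)]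
  have hrm : 0 < r - m := by linarith
  -- the denominator `D = 4 m r² + ϱ²(r−m)` and its bounds `0 < D < 115 m³`
  have hρlo : r ^ 2 ≤ rhoSq a r u := by
    simp only [rhoSq]; nlinarith [mul_nonneg (sq_nonneg a) (sub_nonneg.mpr hu1)]
  have hρhi : rhoSq a r u ≤ r ^ 2 + a ^ 2 := by
    simp only [rhoSq]; nlinarith [mul_nonneg (sq_nonneg a) hu0]
  have ha2 : a ^ 2 ≤ m ^ 2 := by nlinarith [sq_nonneg s]
  have hD0 : 0 < 4 * m * r ^ 2 + rhoSq a r u * (r - m) := by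
    have : 0 < rhoSq a r u * (r - m) := mul_pos (lt_of_lt_of_le (by positivity) hρlo) hrm
    positivity
  have hDhi : 4 * m * r ^ 2 + rhoSq a r u * (r - m) < 115 * m ^ 3 := by
    have h1 : r ^ 2 < 16 * m ^ 2 := by nlinarith
    have h2 : rhoSq a r u < 17 * m ^ 2 := by nlinarith
    have h3 : rhoSq a r u * (r - m) < 17 * m ^ 2 * (3 * m) := by
      have : r - m < 3 * m := by linarith
      have hρ0 : 0 < rhoSq a r u := lt_of_lt_of_le (by positivity) hρlo
      nlinarith [mul_lt_mul'' h2 this hρ0.le hrm.le]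
    nlinarith
  rw [nuNormSq_on_Gamma0 hr0.ne' (ne_of_gt hmr) hμ.ne' hσ hΨ hA]
  have e : m ^ 2 - a ^ 2 = s ^ 2 := by linarith
  rw [e]
  -- numerator `N = 4r((r−m)³ + m s²) > 4 m² s²`
  have hN : 4 * m ^ 2 * s ^ 2 < 4 * r * ((r - m) ^ 3 + m * s ^ 2) := by
    have h1 : 0 < (r - m) ^ 3 := pow_pos hrm 3
    have h2 : m * (m * s ^ 2) < r * ((r - m) ^ 3 + m * s ^ 2) := by
      have : m * s ^ 2 < (r - m) ^ 3 + m * s ^ 2 := by linarith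
      have hms : 0 < m * s ^ 2 := by positivity
      nlinarith [mul_lt_mul'' hmr this hm.le hms.le]
    nlinarith
  have hD2 : (4 * m * r ^ 2 + rhoSq a r u * (r - m)) ^ 2 < (115 * m ^ 3) ^ 2 := by
    nlinarith
  rw [div_lt_div_iff₀ (by positivity) (by positivity)]
  -- `4 s² · D² < N · (115² m⁴)`
  have hs2 : 0 < 4 * s ^ 2 := by positivity
  have step1 : 4 * s ^ 2 * (4 * m * r ^ 2 + rhoSq a r u * (r - m)) ^ 2 < 4 * s ^ 2 * (115 * m ^ 3) ^ 2 :=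
    mul_lt_mul_of_pos_left hD2 hs2
  have step2 : 4 * s ^ 2 * (115 * m ^ 3) ^ 2 = 4 * m ^ 2 * s ^ 2 * (115 ^ 2 * m ^ 4) := by ring
  have step3 : 4 * m ^ 2 * s ^ 2 * (115 ^ 2 * m ^ 4) < 4 * r * ((r - m) ^ 3 + m * s ^ 2) * (115 ^ 2 * m ^ 4) :=
    mul_lt_mul_of_pos_right hN (by positivity)
  linarith

/-- `r < 4𝔪` on `Γ₀ ∖ o` in the polar chart, poles included (from `photonCubic_nonpos_pol`, as module 76 `r_lt_four_m`).
[cite: Hintz2026WavesII, eq. (4.43) `EqTs3bOTrap0Cpt` TeX l.4615-4619 (explicit r_{Γ,+} = 4𝔪, poles included); Chandrasekhar1998, ch. 7 §61 eq. (87)] -/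
theorem r_lt_four_m_pol {ω₁ ω₂ η₁ η₂ : ℝ} (hm : 0 < m) (hs : 0 < s) (has : s ^ 2 + a ^ 2 = m ^ 2) (hr : m + s < r)
    (hu : normSq ω₁ ω₂ < 1) (h0 : OnGamma0Pol m a r ω₁ ω₂ σ ξ η₁ η₂) (hne : ¬(σ = 0 ∧ ξ = 0 ∧ η₁ = 0 ∧ η₂ = 0)) :
    r < 4 * m := by
  have hp := photonCubic_nonpos_pol hm hs has hr hu h0 hne
  simp only [photonCubic] at hp
  by_contra hc
  have hc' : 4 * m ≤ r := not_lt.mp hc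
  have h1 : m ^ 2 ≤ (r - 3 * m) ^ 2 := by nlinarith
  have h2 : 4 * m * m ^ 2 ≤ r * (r - 3 * m) ^ 2 := by nlinarith [sq_nonneg (r - 3 * m)]
  have h3 : 4 * m * a ^ 2 < 4 * m * m ^ 2 := by nlinarith [mul_pos hm (pow_pos hs 2)]
  linarith

/-- **The explicit `ν_min` on `Γ₀ ∖ o`, BL chart** (`0 < sin²θ ≤ 1`, `r > r₊`, `a² = 𝔪² − s²`, `s > 0`): `ν̃² > 4(𝔪²−a²)/(115²𝔪⁴)`.
[cite: Hintz2026WavesII, Lemma 4.18 eq. (4.50) TeX l.4712-4716 (explicit lower bound); Hintz2026WavesII, Def. 5.8 `DefSSTrapAdm` TeX l.5309-5317; Hintz2026, Prop. 8.3 `PropWETr` TeX l.7395-7403 (where ν_min enters)] -/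
theorem nuNormSq_lower_bound_bl {s2 ηφ : ℝ} (hm : 0 < m) (hs : 0 < s) (has : s ^ 2 + a ^ 2 = m ^ 2) (hr : m + s < r)
    (hs20 : 0 < s2) (hs21 : s2 ≤ 1) (h0 : OnGamma0 m a r s2 σ ξ ηθ ηφ) (hne : ¬(σ = 0 ∧ ξ = 0 ∧ ηθ = 0 ∧ ηφ = 0)) :
    4 * s ^ 2 / (115 ^ 2 * m ^ 4) < nuNormSq m a r s2 σ ηφ := by
  obtain ⟨hξ, hΨ, hG⟩ := h0
  have hmr : m < r := by linarith
  have hρ : 0 < rhoSq a r s2 := by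
    simp only [rhoSq]; nlinarith [mul_nonneg (sq_nonneg a) (sub_nonneg.mpr hs21)]
  have hA := A_ne_zero hs20 hρ hξ hG hne
  have hσ := sigma_ne_zero hmr hΨ hA
  have hr4 := r_lt_four_m hm hs has hr hs20 hs21 ⟨hξ, hΨ, hG⟩ hne
  exact nuNormSq_lower_bound hs has hm hr hr4 hs20.le hs21 hσ hΨ hA

/-- **The explicit `ν_min` on `Γ₀ ∖ o`, polar chart, POLES INCLUDED** (`|ω|² < 1`, `r > r₊`, `a² = 𝔪² − s²`, `s > 0`):
`ν̃² > 4(𝔪²−a²)/(115²𝔪⁴)`. [cite: Hintz2026WavesII, Lemma 4.18 eq. (4.50) TeX l.4712-4716 (explicit lower bound, poles included)] -/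
theorem nuNormSq_lower_bound_pol {ω₁ ω₂ η₁ η₂ : ℝ} (hm : 0 < m) (hs : 0 < s) (has : s ^ 2 + a ^ 2 = m ^ 2)
    (hr : m + s < r) (hu : normSq ω₁ ω₂ < 1) (h0 : OnGamma0Pol m a r ω₁ ω₂ σ ξ η₁ η₂)
    (hne : ¬(σ = 0 ∧ ξ = 0 ∧ η₁ = 0 ∧ η₂ = 0)) :
    4 * s ^ 2 / (115 ^ 2 * m ^ 4) < nuNormSq m a r (normSq ω₁ ω₂) σ (Lpol ω₁ ω₂ η₁ η₂) := by
  obtain ⟨hξ, hΨ, hG⟩ := h0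
  have hmr : m < r := by linarith
  have hρ := rhoSq_pol_pos (a := a) hu (by linarith : r ≠ 0)
  have hA := A_ne_zero_pol hu hρ hξ hG hne
  have hσ := sigma_ne_zero hmr hΨ hA
  have hr4 := r_lt_four_m_pol hm hs has hr hu ⟨hξ, hΨ, hG⟩ hne
  have hu0 : 0 ≤ normSq ω₁ ω₂ := by unfold normSq; positivity
  exact nuNormSq_lower_bound hs has hm hr hr4 hu0 hu.le hσ hΨ hA

/-- Sanity: in Schwarzschild (`s = 𝔪`) the bound reads `4/(115²𝔪²) < 1/(27𝔪²)` — consistent with `nuNormSq_schwarzschild` (`27·4 = 108 < 13225`).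
[cite: Dyatlov2015, §3.3 Prop. 3.8 (consistency check computed here)] -/
theorem lower_bound_lt_schwarzschild_value (hm : 0 < m) : 4 * m ^ 2 / (115 ^ 2 * m ^ 4) < 1 / (27 * m ^ 2) := by
  rw [div_lt_div_iff₀ (by positivity) (by positivity)]
  have : 0 < m ^ 6 := by positivity
  nlinarith

end Quantitative

/-! ## 8. [AF] Prop. 4.19(3) on `E`, COMPLETED (v4; computed here): the linearised `(v_θ, v_{η_θ})`-system of l.4935–4942 is a
## HARMONIC OSCILLATOR — elliptic Jacobian, conserved energy, explicit solutions, UNIFORM bounds; the `(v_ϕ, v_{η_ϕ})`-block grows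
## linearly (l.4934) — so on `E` the linearised tangential flow satisfies (4.60) with room to spare -/

section EquatorLinearised

variable {K : ℝ}

/-- The Jacobian of the linearised system on `E` in the `(v_θ, v_{η_θ})`-block: "`∂_sv_θ = 2v_{η_θ}`, `∂_sv_{η_θ} = −∂_θ²𝒞₁·v_θ`"
(`K := ∂_θ²𝒞₁|_E`, the forcing term being `0` by §6). [cite: Hintz2026WavesII, proof of Prop. 4.19(3) TeX l.4935-4938 (transcription of the coefficient matrix)] -/
def tangJac (K : ℝ) : Matrix (Fin 2) (Fin 2) ℝ := !![0, 2; -K, 0]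

/-- **`M² = −2K·1`**: the block is ELLIPTIC for `K > 0` (eigenvalues `±i√(2K)`) — contrast the HYPERBOLIC normal block of module
`KerrTrappingPhasePortrait` (`J² = +σ²ν²·1`): this is `𝔯`-normal hyperbolicity in two lines of linear algebra.
[cite: Hintz2026WavesII, TeX l.4941-4942 ('∂_s²v_θ = −2∂_θ²𝒞₁ v_θ …'; the squared Jacobian computed here)] -/
theorem tangJac_sq : tangJac K * tangJac K = (-(2 * K)) • (1 : Matrix (Fin 2) (Fin 2) ℝ) := by
  ext i j
  fin_cases i <;> fin_cases j <;> (simp [tangJac, Matrix.mul_apply, Fin.sum_univ_two]; try ring)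

/-- **Conserved energy**: along ANY solution of `∂_sv_θ = 2v_η`, `∂_sv_η = −Kv_θ` the quantity `Kv_θ² + 2v_η²` has derivative `0`.
[cite: Hintz2026WavesII, TeX l.4935-4942 (the oscillator; its first integral computed here); Dyatlov2015, §3.2 Prop. 3.6 (held text Prop. 2.6 p.17: tangential growth e^{ε|s|})] -/
theorem energy_hasDerivAt_zero {vθ vη : ℝ → ℝ} {s : ℝ} (h1 : HasDerivAt vθ (2 * vη s) s) (h2 : HasDerivAt vη (-(K * vθ s)) s) :
    HasDerivAt (fun t => K * vθ t ^ 2 + 2 * vη t ^ 2) 0 s := by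
  exact (((h1.fun_pow 2).const_mul K).fun_add ((h2.fun_pow 2).const_mul 2)).congr_deriv (by ring)

/-- … hence it is CONSTANT in `s` (mean value theorem). [cite: Hintz2026WavesII, TeX l.4935-4942 (first integral, computed here)] -/
theorem energy_const {vθ vη : ℝ → ℝ} (h1 : ∀ s, HasDerivAt vθ (2 * vη s) s) (h2 : ∀ s, HasDerivAt vη (-(K * vθ s)) s) (s : ℝ) :
    K * vθ s ^ 2 + 2 * vη s ^ 2 = K * vθ 0 ^ 2 + 2 * vη 0 ^ 2 := by
  have hd : ∀ t, HasDerivAt (fun t => K * vθ t ^ 2 + 2 * vη t ^ 2) 0 t := fun t => energy_hasDerivAt_zero (h1 t) (h2 t)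
  exact is_const_of_deriv_eq_zero (fun t => (hd t).differentiableAt) (fun t => (hd t).deriv) s 0

/-- **UNIFORM BOUNDS for `K > 0`**: every solution satisfies `K·v_θ(s)² ≤ E₀` and `2·v_η(s)² ≤ E₀` with `E₀ := Kv_θ(0)² + 2v_η(0)²`, for
ALL `s` — no growth at all in the `(v_θ, v_{η_θ})`-block (so a fortiori `≤ e^{εs}` as (4.60) asks).
[cite: Hintz2026WavesII, Prop. 4.19(3) eq. (4.54) and TeX l.4904-4907 ('|De^{TH_{𝒞₁}}v₀| ≤ e^{εT}|v₀|') with l.4935-4948 (the E-case; bound computed here); Dyatlov2015, §3.2 Prop. 3.6] -/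
theorem tangential_block_bounded (hK : 0 < K) {vθ vη : ℝ → ℝ} (h1 : ∀ s, HasDerivAt vθ (2 * vη s) s)
    (h2 : ∀ s, HasDerivAt vη (-(K * vθ s)) s) (s : ℝ) :
    K * vθ s ^ 2 ≤ K * vθ 0 ^ 2 + 2 * vη 0 ^ 2 ∧ 2 * vη s ^ 2 ≤ K * vθ 0 ^ 2 + 2 * vη 0 ^ 2 := by
  have h := energy_const h1 h2 s
  have hθ : 0 ≤ K * vθ s ^ 2 := by positivity
  have hη : 0 ≤ 2 * vη s ^ 2 := by positivity
  constructor <;> linarith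

/-- **The explicit solution** (`ω := √(2K)`, `K > 0`): `v_θ(s) = v_θ(0)cos(ωs) + (2v_η(0)/ω)sin(ωs)`,
`v_η(s) = v_η(0)cos(ωs) − (ωv_θ(0)/2)sin(ωs)` solves `∂_sv_θ = 2v_η`, `∂_sv_η = −Kv_θ` (certified `HasDerivAt` in `s`).
[cite: Hintz2026WavesII, TeX l.4935-4942 (the oscillator solved here)] -/
theorem oscillator_solution (hK : 0 < K) (vθ0 vη0 s : ℝ) :
    HasDerivAt (fun t => vθ0 * Real.cos (Real.sqrt (2 * K) * t) + 2 * vη0 / Real.sqrt (2 * K) * Real.sin (Real.sqrt (2 * K) * t))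
        (2 * (vη0 * Real.cos (Real.sqrt (2 * K) * s) - Real.sqrt (2 * K) * vθ0 / 2 * Real.sin (Real.sqrt (2 * K) * s))) s ∧
      HasDerivAt (fun t => vη0 * Real.cos (Real.sqrt (2 * K) * t) - Real.sqrt (2 * K) * vθ0 / 2 * Real.sin (Real.sqrt (2 * K) * t))
        (-(K * (vθ0 * Real.cos (Real.sqrt (2 * K) * s) + 2 * vη0 / Real.sqrt (2 * K) * Real.sin (Real.sqrt (2 * K) * s)))) s := by
  set ω := Real.sqrt (2 * K) with hω
  have hωpos : 0 < ω := Real.sqrt_pos.mpr (by linarith)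
  have hω2 : ω ^ 2 = 2 * K := Real.sq_sqrt (by linarith)
  have hlin : HasDerivAt (fun t : ℝ => ω * t) ω s := by simpa using (hasDerivAt_id' s).const_mul ω
  have hcos : HasDerivAt (fun t : ℝ => Real.cos (ω * t)) (-Real.sin (ω * s) * ω) s := (Real.hasDerivAt_cos (ω * s)).comp s hlin
  have hsin : HasDerivAt (fun t : ℝ => Real.sin (ω * t)) (Real.cos (ω * s) * ω) s := (Real.hasDerivAt_sin (ω * s)).comp s hlin
  constructor
  · refine ((hcos.const_mul vθ0).fun_add (hsin.const_mul (2 * vη0 / ω))).congr_deriv ?_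
    field_simp
    ring
  · refine ((hcos.const_mul vη0).fun_sub (hsin.const_mul (ω * vθ0 / 2))).congr_deriv ?_
    have : K = ω ^ 2 / 2 := by rw [hω2]; ring
    rw [this]
    field_simp
    ring

/-- **The `(v_ϕ, v_{η_ϕ})`-block** (l.4934): "`∂_sv_{η_ϕ} = 0`, so `v_{η_ϕ}(s) = v_{η_ϕ}(0)`, and `∂_sv_ϕ = 2v_{η_ϕ}(0)`; these two
components grow at most linearly in `s`" — the explicit solution `v_ϕ(s) = v_ϕ(0) + 2sv_{η_ϕ}(0)`, certified.
[cite: Hintz2026WavesII, TeX l.4934 (reproduced)] -/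
theorem phi_block_solution (vφ0 vL0 s : ℝ) :
    HasDerivAt (fun t : ℝ => vφ0 + 2 * t * vL0) (2 * vL0) s ∧ HasDerivAt (fun _ : ℝ => vL0) 0 s := by
  refine ⟨?_, hasDerivAt_const s vL0⟩
  simpa using (((hasDerivAt_id' s).const_mul 2).mul_const vL0).const_add vφ0

/-- **ASSEMBLED ON `E ∖ o`** (`sin²θ = 1`, `η_θ = 0`, `ξ = 0`, `G_3b = 0`, `r > 𝔪 > 0`, `μ > 0`, every real `a`): the coefficient
`K = ∂_θ²𝒞|_{θ=π/2} = 2(η_ϕ² − a²σ²)` exceeds `2𝔪²σ² ≥ 0` and is POSITIVE (§6 `d2Carter_equator_gt`, `etaphi_sq_gt`), so every solution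
of the linearised `(v_θ, v_{η_θ})`-system is uniformly bounded by its conserved energy — [AF]'s "it remains to show that … `∂_θ²𝒞₁` is
positive", now with the conclusion it serves. [cite: Hintz2026WavesII, TeX l.4944-4948 with l.4935-4942 and (4.54)/(4.60) (reproduced and completed on E); Dyatlov2015, §3.2 Prop. 3.6 (held text Prop. 2.6, Case K̃_e p.16-17)] -/
theorem equator_tangential_bounded {m a r σ ξ ηφ : ℝ} (hm : 0 < m) (hmr : m < r) (hμ : 0 < mu m a r) (hξ : ξ = 0)
    (hG : G3b m a r 1 σ ξ 0 ηφ = 0) (hne : ¬(σ = 0 ∧ ξ = 0 ∧ (0 : ℝ) = 0 ∧ ηφ = 0))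
    {vθ vη : ℝ → ℝ} (h1 : ∀ s, HasDerivAt vθ (2 * vη s) s)
    (h2 : ∀ s, HasDerivAt vη (-(d2Carter a σ ηφ (Real.pi / 2) * vθ s)) s) (s : ℝ) :
    0 < d2Carter a σ ηφ (Real.pi / 2) ∧
      d2Carter a σ ηφ (Real.pi / 2) * vθ s ^ 2 ≤ d2Carter a σ ηφ (Real.pi / 2) * vθ 0 ^ 2 + 2 * vη 0 ^ 2 ∧
      2 * vη s ^ 2 ≤ d2Carter a σ ηφ (Real.pi / 2) * vθ 0 ^ 2 + 2 * vη 0 ^ 2 := by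
  obtain ⟨hgt, hge⟩ := d2Carter_equator_gt hm hmr hμ hξ hG hne
  have hK : 0 < d2Carter a σ ηφ (Real.pi / 2) := by
    have : 0 ≤ 2 * m ^ 2 * σ ^ 2 := by positivity
    linarith
  exact ⟨hK, tangential_block_bounded hK h1 h2 s⟩

end EquatorLinearised

end Literature.Geometry.Lorentzian.Hintz2026.KerrTrappedSetDynamics

end
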